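import Literature.Analysis.FluidPDE.NSRegFourierEnergy
import Literature.Analysis.FluidPDE.NSRegFourierWeakForm
import Literature.Analysis.FluidPDE.NSRegFourierMollifier
import Literature.Analysis.FluidPDE.TaoEnergyLocalisationProofs
import Literature.Analysis.FluidPDE.SobolevWholeSpace
import Literature.Analysis.FluidPDE.EnergyToolkit
import HarnessLib

/-!
# The far-field energy estimate for the regularised solution

Fifteenth file of the Fourier-side construction of the global regular solution of the
Leray-regularised Navier–Stokes system (discharge of
`Literature.Analysis.FluidPDE.leray_regularised_wellposed`): the last clause of that fact, Leray's
"separation of energy" for the regularised solution in dimension three (Leray 1934, §27, (5.7)–(5.8);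
Ożański–Pooley 2018, Lemma 6.34): for `0 < R₁ < R₂` and `t ≥ 0`,

  `∫_{‖x‖>R₂} ‖u(t)‖² ≤ ∫_{‖x‖>R₁} ‖u(0)‖² + C(ν) (M²√t + M³ t^{1/4}) / (R₂ − R₁)`, `M = ‖u₀‖_{L²}`,

with a constant independent of the mollifier. Proof: subtract from the global energy equality
(`RegSetup.energyEq`) the localised energy balance of the tree
(`IsClassicalNSSolutionOn.energy_balance_cutoff`) for the compactly supported far-field cut-off
`η = taoCutoff R₂ (R₂ − R₁)` of the tree (`TaoEnergyLocalisation`; gradient `O(1/(R₂ − R₁))` by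
`exists_norm_fderiv_taoCutoff_le`); the
transport term of the fictitious force recombines by integration by parts (`div u = div Ju = 0`);
the three cut-off terms are bounded, uniformly in the mollifier, through `‖J_χ u‖₄ ≤ ‖u‖₄` (Young),
the interpolation `‖u‖₄² ≤ ‖u‖₂^{1/2} ‖u‖₆^{3/2}`, the Sobolev inequality `‖u‖₆ ≤ K ‖∇u‖₂` in `ℝ³`
(`SobolevWholeSpace`), the pressure bound `‖p‖₂ ≤ 9 ‖J_χu‖₄ ‖u‖₄` (Plancherel on the Fourier
side), and Hölder in time against the dissipation `∫₀ᵗ‖∇u‖₂² ≤ M²/(2ν)`.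

## References

* J. Leray, Acta Math. 63 (1934), Ch. V §27, (5.7)–(5.8). [Leray1934]
* W. S. Ożański, B. C. Pooley, LMS Lecture Note Ser. 452 (2018), Lemma 6.34, (6.90)–(6.92). [OzanskiPooley2018]
-/

noncomputable section

open MeasureTheory Real Set Filter Topology Function Complex FourierTransform InnerProductSpace
open scoped FourierTransform RealInnerProductSpace ENNReal ComplexConjugate

namespace Literature.Analysis.FluidPDE.FourierNS

open ClayDatum (reVec reVec_apply inner_eq_sum')

/-- `ℝ³` as a Euclidean space. -/
local notation "E3" => EuclideanSpace ℝ (Fin 3)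

namespace RegSetup

variable (d : RegSetup (Fin 3))

/-! ### Slice estimates: Sobolev, interpolation, transport, viscous cross term -/

/-- The Sobolev constant `K` of `‖u‖₆ ≤ K ‖Du‖₂` in `ℝ³` (`SobolevWholeSpace`). [folklore] -/
def KS : ℝ := (SNormLESNormFDerivOfEqConst E3 (volume : Measure E3) 2 : ℝ)

omit d in
/-- `0 ≤ K`. [folklore] -/
theorem KS_nonneg : 0 ≤ KS := NNReal.coe_nonneg _

/-- The real dissipation of a slice, `F(τ) = ∫ |∇u(τ)|²`. [folklore] -/
def Fd (τ : ℝ) : ℝ := ∫ x, frobeniusNormSq (fderiv ℝ (d.u τ) x)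

/-- `F ≥ 0`. [folklore] -/
theorem Fd_nonneg (τ : ℝ) : 0 ≤ d.Fd τ := integral_nonneg fun _ => frobeniusNormSq_nonneg _

/-- The real energy of a slice, `E₂(τ) = ∫ ‖u(τ)‖²`. [folklore] -/
def E2 (τ : ℝ) : ℝ := ∫ x, ‖d.u τ x‖ ^ 2

/-- `E₂ ≥ 0`. [folklore] -/
theorem E2_nonneg (τ : ℝ) : 0 ≤ d.E2 τ := integral_nonneg fun _ => by positivity

/-- The velocity slice is `C¹`. [folklore] -/
theorem contDiff_u {τ : ℝ} (hτ : τ ∈ Icc 0 d.T) (n : ℕ) : ContDiff ℝ n (d.u τ) :=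
  contDiff_infty.1 (d.smooth_u.contDiff_slice hτ) n

/-- **The operator-norm gradient is dominated by the dissipation**: `‖Du(τ)‖_{L²} ≤ F(τ)^{1/2}`. [folklore] -/
theorem eLpNorm_fderiv_u_le {τ : ℝ} (hτ : τ ∈ Icc 0 d.T) :
    eLpNorm (fderiv ℝ (d.u τ)) 2 volume ≤ ENNReal.ofReal ((d.Fd τ) ^ (1 / 2 : ℝ)) := by
  obtain ⟨hi, -⟩ := d.integral_frobeniusNormSq_fderiv_u hτ
  rw [eLpNorm_eq_lintegral_rpow_enorm_toReal two_ne_zero ENNReal.ofNat_ne_top, ENNReal.toReal_ofNat,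
    ← ENNReal.ofReal_rpow_of_nonneg (d.Fd_nonneg τ) (by norm_num)]
  refine ENNReal.rpow_le_rpow ?_ (by norm_num)
  rw [Fd, ofReal_integral_eq_lintegral_ofReal hi (Eventually.of_forall fun x => frobeniusNormSq_nonneg _)]
  refine lintegral_mono fun x => ?_
  rw [show (2 : ℝ) = (2 : ℕ) by norm_num, ENNReal.rpow_natCast, ← ofReal_norm, ← ENNReal.ofReal_pow (norm_nonneg _)]
  exact ENNReal.ofReal_le_ofReal (sq_opNorm_le_frobeniusNormSq _)

/-- **Sobolev for the velocity slice**: `u(τ) ∈ L⁶` with `∫ ‖u(τ)‖⁶ ≤ K⁶ F(τ)³`. [folklore] -/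
theorem integral_norm_pow_six_u_le {τ : ℝ} (hτ : τ ∈ Icc 0 d.T) :
    MemLp (d.u τ) 6 volume ∧ ∫ x, ‖d.u τ x‖ ^ 6 ≤ KS ^ 6 * (d.Fd τ) ^ 3 := by
  have h6 := eLpNorm_six_le_eLpNorm_fderiv_two (F := E3) (volume : Measure E3) finrank_euclideanSpace_fin
    (d.contDiff_u hτ 1) (d.memLp_u hτ).eLpNorm_lt_top
  have hbound : eLpNorm (d.u τ) 6 volume ≤ ENNReal.ofReal (KS * (d.Fd τ) ^ (1 / 2 : ℝ)) := by
    refine h6.trans ?_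
    rw [ENNReal.ofReal_mul KS_nonneg, KS, ENNReal.ofReal_coe_nnreal]
    exact mul_le_mul_right (d.eLpNorm_fderiv_u_le hτ) _
  have hmem : MemLp (d.u τ) 6 volume :=
    ⟨(d.continuous_u hτ).aestronglyMeasurable, hbound.trans_lt ENNReal.ofReal_lt_top⟩
  refine ⟨hmem, ?_⟩
  have heq := hmem.eLpNorm_eq_integral_rpow_norm (by norm_num) (by norm_num)
  simp only [ENNReal.toReal_ofNat] at heq
  have hI : 0 ≤ ∫ x, ‖d.u τ x‖ ^ (6 : ℝ) := integral_nonneg fun x => by positivity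
  rw [heq] at hbound
  have h1 : (∫ x, ‖d.u τ x‖ ^ (6 : ℝ)) ^ (6 : ℝ)⁻¹ ≤ KS * (d.Fd τ) ^ (1 / 2 : ℝ) :=
    (ENNReal.ofReal_le_ofReal_iff (mul_nonneg KS_nonneg (Real.rpow_nonneg (d.Fd_nonneg τ) _))).1 hbound
  have h2 := pow_le_pow_left₀ (Real.rpow_nonneg hI _) h1 6
  rw [← Real.rpow_natCast, ← Real.rpow_mul hI] at h2
  norm_num at h2
  refine h2.trans (le_of_eq ?_)
  rw [mul_pow, ← Real.rpow_natCast ((d.Fd τ) ^ (1 / 2 : ℝ)) 6, ← Real.rpow_mul (d.Fd_nonneg τ)]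
  norm_num

/-- **The `L⁴` bound of the velocity slice**: `∫ ‖u(τ)‖⁴ ≤ E₂(τ)^{1/2} K³ F(τ)^{3/2}`
(interpolation between `L²` and `L⁶`, then Sobolev). [folklore] -/
theorem integral_norm_pow_four_u_le {τ : ℝ} (hτ : τ ∈ Icc 0 d.T) :
    ∫ x, ‖d.u τ x‖ ^ 4 ≤ Real.sqrt (d.E2 τ) * (KS ^ 3 * (d.Fd τ) ^ (3 / 2 : ℝ)) := by
  obtain ⟨h6, hI6⟩ := d.integral_norm_pow_six_u_le hτ
  refine (integral_norm_pow_four_le (d.memLp_u hτ) h6).trans (mul_le_mul_of_nonneg_left ?_ (Real.sqrt_nonneg _))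
  calc Real.sqrt (∫ x, ‖d.u τ x‖ ^ 6) ≤ Real.sqrt (KS ^ 6 * (d.Fd τ) ^ 3) := Real.sqrt_le_sqrt hI6
    _ = KS ^ 3 * (d.Fd τ) ^ (3 / 2 : ℝ) := by
        rw [Real.sqrt_mul (pow_nonneg KS_nonneg 6), show KS ^ 6 = (KS ^ 3) ^ 2 by ring, Real.sqrt_sq (pow_nonneg KS_nonneg 3),
          Real.sqrt_eq_rpow, ← Real.rpow_natCast (d.Fd τ) 3, ← Real.rpow_mul (d.Fd_nonneg τ)]
        norm_num

/-! ### `L⁴` bookkeeping -/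

omit d in
/-- `L² ∩ L⁶ ⊂ L⁴` for continuous fields (pointwise `a⁴ ≤ a² + a⁶`). [folklore] -/
theorem memLp_four_of_two_six {v : E3 → E3} (hv : Continuous v) (h2 : MemLp v 2 volume) (h6 : MemLp v 6 volume) :
    MemLp v 4 volume := by
  have hm : Measurable fun x => ‖v x‖ₑ := hv.measurable.enorm
  have hlt : ∀ {p : ℝ}, 0 < p → MemLp v (ENNReal.ofReal p) volume → ∫⁻ x, ‖v x‖ₑ ^ p < ⊤ := by
    intro p hp h
    have := h.2
    rw [eLpNorm_eq_lintegral_rpow_enorm_toReal (by simp [hp]) ENNReal.ofReal_ne_top, ENNReal.toReal_ofReal hp.le] at this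
    exact (ENNReal.rpow_lt_top_iff_of_pos (by positivity)).1 this
  have hlt2 : ∫⁻ x, ‖v x‖ₑ ^ (2 : ℝ) < ⊤ := hlt two_pos (by simpa using h2)
  have hlt6 : ∫⁻ x, ‖v x‖ₑ ^ (6 : ℝ) < ⊤ := hlt (by norm_num) (by simpa using h6)
  refine ⟨h2.1, ?_⟩
  rw [eLpNorm_eq_lintegral_rpow_enorm_toReal (by norm_num) (by norm_num), ENNReal.toReal_ofNat]
  refine ENNReal.rpow_lt_top_of_nonneg (by norm_num) (ne_of_lt ?_)
  calc ∫⁻ x, ‖v x‖ₑ ^ (4 : ℝ) ≤ ∫⁻ x, (‖v x‖ₑ ^ (2 : ℝ) + ‖v x‖ₑ ^ (6 : ℝ)) := by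
        refine lintegral_mono fun x => ?_
        rcases le_total (‖v x‖ₑ) 1 with h | h
        · exact (ENNReal.rpow_le_rpow_of_exponent_ge h (by norm_num : (2:ℝ) ≤ 4)).trans le_self_add
        · exact (ENNReal.rpow_le_rpow_of_exponent_le h (by norm_num : (4:ℝ) ≤ 6)).trans le_add_self
    _ = (∫⁻ x, ‖v x‖ₑ ^ (2 : ℝ)) + ∫⁻ x, ‖v x‖ₑ ^ (6 : ℝ) := lintegral_add_left (hm.pow_const _) _
    _ < ⊤ := ENNReal.add_lt_top.2 ⟨hlt2, hlt6⟩

omit d in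
/-- `∫ ‖v‖⁴ = ‖v‖₄⁴` for `v ∈ L⁴`. [folklore] -/
theorem integral_norm_pow_four_eq {v : E3 → E3} (hv : MemLp v 4 volume) :
    ∫ x, ‖v x‖ ^ 4 = (eLpNorm v 4 volume).toReal ^ 4 := by
  have heq := hv.eLpNorm_eq_integral_rpow_norm (by norm_num) (by norm_num)
  simp only [ENNReal.toReal_ofNat] at heq
  have hI : 0 ≤ ∫ x, ‖v x‖ ^ (4 : ℝ) := integral_nonneg fun x => by positivity
  rw [heq, ENNReal.toReal_ofReal (Real.rpow_nonneg hI _), ← Real.rpow_natCast, ← Real.rpow_mul hI]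
  norm_num

omit d in
/-- `‖v‖⁴` is integrable for `v ∈ L⁴`. [folklore] -/
theorem integrable_norm_pow_four {v : E3 → E3} (hv : MemLp v 4 volume) : Integrable (fun x => ‖v x‖ ^ 4) volume := by
  have h : MemLp v ((4 : ℕ) : ℝ≥0∞) volume := by simpa using hv
  exact h.integrable_norm_pow (by norm_num)

omit d in
/-- **Young for the mollification in `L⁴`**: `∫ ‖J_χ v‖⁴ ≤ ∫ ‖v‖⁴` (unit-mass kernel). [folklore] -/
theorem integral_norm_pow_four_mollify_le (χ : ContDiffBump (0 : E3)) {v : E3 → E3} (hv : MemLp v 4 volume) :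
    MemLp (mollify χ v) 4 volume ∧ ∫ x, ‖mollify χ v x‖ ^ 4 ≤ ∫ x, ‖v x‖ ^ 4 := by
  have hm : MemLp (mollify χ v) 4 volume := FunctionSpaces.memLp_normed_convolution χ hv (by norm_num)
  refine ⟨hm, ?_⟩
  rw [integral_norm_pow_four_eq hm, integral_norm_pow_four_eq hv]
  have hle : eLpNorm (mollify χ v) 4 volume ≤ eLpNorm v 4 volume :=
    FunctionSpaces.eLpNorm_normed_convolution_le χ hv.1 (by norm_num)
  exact pow_le_pow_left₀ ENNReal.toReal_nonneg (ENNReal.toReal_mono hv.eLpNorm_ne_top hle) 4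

/-! ### The transport term: `∫ ‖J u‖ ‖u‖² ≤ ‖u‖₄² ‖u‖₂` -/

variable (χ : ContDiffBump (0 : E3))

/-- `u(τ) ∈ L⁴` and `J u(τ) ∈ L⁴` with `∫ ‖Ju‖⁴ ≤ ∫ ‖u‖⁴`. [folklore] -/
theorem memLp_four_u (hm : d.m = msymbol χ) {τ : ℝ} (hτ : τ ∈ Icc 0 d.T) :
    MemLp (d.u τ) 4 volume ∧ MemLp (d.ju τ) 4 volume ∧ ∫ x, ‖d.ju τ x‖ ^ 4 ≤ ∫ x, ‖d.u τ x‖ ^ 4 := by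
  have h4 : MemLp (d.u τ) 4 volume :=
    memLp_four_of_two_six (d.continuous_u hτ) (d.memLp_u hτ) (d.integral_norm_pow_six_u_le hτ).1
  have hJ := integral_norm_pow_four_mollify_le χ h4
  rw [← d.ju_eq_mollify χ hm hτ] at hJ
  exact ⟨h4, hJ.1, hJ.2⟩

/-- **`∫ ‖Ju‖² ‖u‖² ≤ ∫ ‖u‖⁴`** (Cauchy–Schwarz and Young). [folklore] -/
theorem integral_norm_ju_sq_mul_norm_sq_le (hm : d.m = msymbol χ) {τ : ℝ} (hτ : τ ∈ Icc 0 d.T) :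
    Integrable (fun x => ‖d.ju τ x‖ ^ 2 * ‖d.u τ x‖ ^ 2) volume ∧
      ∫ x, ‖d.ju τ x‖ ^ 2 * ‖d.u τ x‖ ^ 2 ≤ ∫ x, ‖d.u τ x‖ ^ 4 := by
  obtain ⟨h4, hJ4, hle⟩ := d.memLp_four_u χ hm hτ
  have iu := integrable_norm_pow_four h4
  have iJ := integrable_norm_pow_four hJ4
  have hint : Integrable (fun x => ‖d.ju τ x‖ ^ 2 * ‖d.u τ x‖ ^ 2) volume := by
    refine ((iJ.add iu).div_const 2).mono' (((hJ4.1.norm.aemeasurable.pow_const 2).mul (h4.1.norm.aemeasurable.pow_const 2)).aestronglyMeasurable) (Eventually.of_forall fun x => ?_)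
    rw [Real.norm_of_nonneg (by positivity)]
    have := two_mul_le_add_sq (‖d.ju τ x‖ ^ 2) (‖d.u τ x‖ ^ 2)
    have e : ‖d.ju τ x‖ ^ 4 + ‖d.u τ x‖ ^ 4 = (‖d.ju τ x‖ ^ 2) ^ 2 + (‖d.u τ x‖ ^ 2) ^ 2 := by ring
    change ‖d.ju τ x‖ ^ 2 * ‖d.u τ x‖ ^ 2 ≤ (‖d.ju τ x‖ ^ 4 + ‖d.u τ x‖ ^ 4) / 2
    rw [e]; linarith
  refine ⟨hint, ?_⟩
  have hCS := integral_mul_le_sqrt_mul_sqrt (μ := volume) (f := fun x => ‖d.ju τ x‖ ^ 2) (g := fun x => ‖d.u τ x‖ ^ 2)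
    (fun x => by positivity) (fun x => by positivity) (hJ4.1.norm.aemeasurable.pow_const 2).aestronglyMeasurable
    (h4.1.norm.aemeasurable.pow_const 2).aestronglyMeasurable
    (iJ.congr (Eventually.of_forall fun x => by ring)) (iu.congr (Eventually.of_forall fun x => by ring))
  refine hCS.trans ?_
  have e1 : ∫ x, (‖d.ju τ x‖ ^ 2) ^ 2 = ∫ x, ‖d.ju τ x‖ ^ 4 := integral_congr_ae (Eventually.of_forall fun x => by ring)
  have e2 : ∫ x, (‖d.u τ x‖ ^ 2) ^ 2 = ∫ x, ‖d.u τ x‖ ^ 4 := integral_congr_ae (Eventually.of_forall fun x => by ring)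
  rw [e1, e2]
  have h0 : 0 ≤ ∫ x, ‖d.u τ x‖ ^ 4 := integral_nonneg fun x => by positivity
  calc Real.sqrt (∫ x, ‖d.ju τ x‖ ^ 4) * Real.sqrt (∫ x, ‖d.u τ x‖ ^ 4)
      ≤ Real.sqrt (∫ x, ‖d.u τ x‖ ^ 4) * Real.sqrt (∫ x, ‖d.u τ x‖ ^ 4) :=
        mul_le_mul_of_nonneg_right (Real.sqrt_le_sqrt hle) (Real.sqrt_nonneg _)
    _ = ∫ x, ‖d.u τ x‖ ^ 4 := Real.mul_self_sqrt h0

/-- **The transport slice bound**: `∫ ‖Ju(τ)‖ ‖u(τ)‖² ≤ (∫‖u‖⁴)^{1/2} E₂(τ)^{1/2}`. [folklore] -/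
theorem integral_norm_ju_mul_norm_sq_le (hm : d.m = msymbol χ) {τ : ℝ} (hτ : τ ∈ Icc 0 d.T) :
    ∫ x, ‖d.ju τ x‖ * ‖d.u τ x‖ ^ 2 ≤ Real.sqrt (∫ x, ‖d.u τ x‖ ^ 4) * Real.sqrt (d.E2 τ) := by
  obtain ⟨hint, hle⟩ := d.integral_norm_ju_sq_mul_norm_sq_le χ hm hτ
  have hu2 : Integrable (fun x => ‖d.u τ x‖ ^ 2) volume := IsRegMild.integrable_normSq_of_memLp (d.memLp_u hτ)
  have hjc : Continuous (d.ju τ) := (d.contDiff_ju hτ 1).continuous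
  have hCS := integral_mul_le_sqrt_mul_sqrt (μ := volume) (f := fun x => ‖d.ju τ x‖ * ‖d.u τ x‖) (g := fun x => ‖d.u τ x‖)
    (fun x => by positivity) (fun x => norm_nonneg _) ((hjc.norm.mul (d.continuous_u hτ).norm).aestronglyMeasurable)
    (d.continuous_u hτ).norm.aestronglyMeasurable (hint.congr (Eventually.of_forall fun x => by ring)) hu2
  have e : ∫ x, ‖d.ju τ x‖ * ‖d.u τ x‖ * ‖d.u τ x‖ = ∫ x, ‖d.ju τ x‖ * ‖d.u τ x‖ ^ 2 :=
    integral_congr_ae (Eventually.of_forall fun x => by ring)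
  rw [e] at hCS
  refine hCS.trans (mul_le_mul_of_nonneg_right (Real.sqrt_le_sqrt ?_) (Real.sqrt_nonneg _))
  calc ∫ x, (‖d.ju τ x‖ * ‖d.u τ x‖) ^ 2 = ∫ x, ‖d.ju τ x‖ ^ 2 * ‖d.u τ x‖ ^ 2 :=
        integral_congr_ae (Eventually.of_forall fun x => by ring)
    _ ≤ ∫ x, ‖d.u τ x‖ ^ 4 := hle

/-! ### The viscous cross term: `∫ ∑ᵢ |∂ᵢφ| |⟪∂ᵢu, u⟫| ≤ 3 C (F E₂)^{1/2}` -/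

/-- Directional derivatives are square integrable, dominated by the dissipation:
`∫ ‖∂ᵢu(τ)‖² ≤ F(τ)`. [folklore] -/
theorem integral_norm_fderiv_apply_sq_le {τ : ℝ} (hτ : τ ∈ Icc 0 d.T) (i : Fin (Module.finrank ℝ E3)) :
    Integrable (fun x => ‖fderiv ℝ (d.u τ) x (stdOrthonormalBasis ℝ E3 i)‖ ^ 2) volume ∧
      ∫ x, ‖fderiv ℝ (d.u τ) x (stdOrthonormalBasis ℝ E3 i)‖ ^ 2 ≤ d.Fd τ := by
  obtain ⟨hi, -⟩ := d.integral_frobeniusNormSq_fderiv_u hτ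
  have hc : Continuous fun x => ‖fderiv ℝ (d.u τ) x (stdOrthonormalBasis ℝ E3 i)‖ ^ 2 :=
    (((d.contDiff_u hτ 1).continuous_fderiv one_ne_zero).clm_apply continuous_const).norm.pow 2
  have hle : ∀ x, ‖fderiv ℝ (d.u τ) x (stdOrthonormalBasis ℝ E3 i)‖ ^ 2 ≤ frobeniusNormSq (fderiv ℝ (d.u τ) x) := fun x =>
    Finset.single_le_sum (f := fun i => ‖fderiv ℝ (d.u τ) x (stdOrthonormalBasis ℝ E3 i)‖ ^ 2) (fun i _ => by positivity)
      (Finset.mem_univ i)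
  have hint : Integrable (fun x => ‖fderiv ℝ (d.u τ) x (stdOrthonormalBasis ℝ E3 i)‖ ^ 2) volume :=
    hi.mono' hc.aestronglyMeasurable (Eventually.of_forall fun x => by
      rw [Real.norm_of_nonneg (by positivity)]; exact hle x)
  exact ⟨hint, integral_mono hint hi hle⟩

/-- **The viscous cross slice bound**: if `‖Dφ‖ ≤ C` then
`∫ |∑ᵢ ∂ᵢφ ⟪∂ᵢu(τ), u(τ)⟫| ≤ 3 C F(τ)^{1/2} E₂(τ)^{1/2}`. [folklore] -/
theorem integral_abs_sum_fderiv_mul_inner_le {φ : E3 → ℝ} {C : ℝ} (hC : ∀ x, ‖fderiv ℝ φ x‖ ≤ C) (hC0 : 0 ≤ C)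
    {τ : ℝ} (hτ : τ ∈ Icc 0 d.T) :
    Integrable (fun x => ∑ i, |fderiv ℝ φ x (stdOrthonormalBasis ℝ E3 i) *
        ⟪fderiv ℝ (d.u τ) x (stdOrthonormalBasis ℝ E3 i), d.u τ x⟫|) volume ∧
      ∫ x, ∑ i, |fderiv ℝ φ x (stdOrthonormalBasis ℝ E3 i) * ⟪fderiv ℝ (d.u τ) x (stdOrthonormalBasis ℝ E3 i), d.u τ x⟫| ≤
        3 * C * (Real.sqrt (d.Fd τ) * Real.sqrt (d.E2 τ)) := by
  set b := stdOrthonormalBasis ℝ E3 with hb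
  have hcard : (Finset.univ : Finset (Fin (Module.finrank ℝ E3))).card = 3 := by
    rw [Finset.card_univ, Fintype.card_fin, finrank_euclideanSpace_fin]
  have huc := d.continuous_u hτ
  have hDuc : Continuous (fderiv ℝ (d.u τ)) := (d.contDiff_u hτ 1).continuous_fderiv one_ne_zero
  have hu2 : Integrable (fun x => ‖d.u τ x‖ ^ 2) volume := IsRegMild.integrable_normSq_of_memLp (d.memLp_u hτ)
  -- each term: `|∂ᵢφ ⟪∂ᵢu, u⟫| ≤ C ‖∂ᵢu‖ ‖u‖`, and `∫ ‖∂ᵢu‖ ‖u‖ ≤ √F √E₂`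
  have hterm : ∀ i, Integrable (fun x => ‖fderiv ℝ (d.u τ) x (b i)‖ * ‖d.u τ x‖) volume ∧
      ∫ x, ‖fderiv ℝ (d.u τ) x (b i)‖ * ‖d.u τ x‖ ≤ Real.sqrt (d.Fd τ) * Real.sqrt (d.E2 τ) := by
    intro i
    obtain ⟨hi2, hiF⟩ := d.integral_norm_fderiv_apply_sq_le hτ i
    have hic : Continuous fun x => ‖fderiv ℝ (d.u τ) x (b i)‖ := (hDuc.clm_apply continuous_const).norm
    have hint : Integrable (fun x => ‖fderiv ℝ (d.u τ) x (b i)‖ * ‖d.u τ x‖) volume := by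
      refine ((hi2.add hu2).div_const 2).mono' (hic.mul huc.norm).aestronglyMeasurable (Eventually.of_forall fun x => ?_)
      rw [Real.norm_of_nonneg (by positivity)]
      have := two_mul_le_add_sq ‖fderiv ℝ (d.u τ) x (b i)‖ ‖d.u τ x‖
      change ‖fderiv ℝ (d.u τ) x (b i)‖ * ‖d.u τ x‖ ≤ (‖fderiv ℝ (d.u τ) x (b i)‖ ^ 2 + ‖d.u τ x‖ ^ 2) / 2
      linarith
    refine ⟨hint, ?_⟩
    have hCS := integral_mul_le_sqrt_mul_sqrt (μ := volume) (f := fun x => ‖fderiv ℝ (d.u τ) x (b i)‖) (g := fun x => ‖d.u τ x‖)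
      (fun x => norm_nonneg _) (fun x => norm_nonneg _) hic.aestronglyMeasurable huc.norm.aestronglyMeasurable hi2 hu2
    exact hCS.trans (mul_le_mul_of_nonneg_right (Real.sqrt_le_sqrt hiF) (Real.sqrt_nonneg _))
  have hpt : ∀ x i, |fderiv ℝ φ x (b i) * ⟪fderiv ℝ (d.u τ) x (b i), d.u τ x⟫| ≤ C * (‖fderiv ℝ (d.u τ) x (b i)‖ * ‖d.u τ x‖) := by
    intro x i
    rw [abs_mul]
    refine mul_le_mul ?_ (abs_real_inner_le_norm _ _) (abs_nonneg _) hC0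
    calc |fderiv ℝ φ x (b i)| = ‖fderiv ℝ φ x (b i)‖ := (Real.norm_eq_abs _).symm
      _ ≤ ‖fderiv ℝ φ x‖ * ‖b i‖ := ContinuousLinearMap.le_opNorm _ _
      _ ≤ C := by rw [b.orthonormal.1 i, mul_one]; exact hC x
  have hsumint : Integrable (fun x => ∑ i, C * (‖fderiv ℝ (d.u τ) x (b i)‖ * ‖d.u τ x‖)) volume :=
    integrable_finsetSum _ fun i _ => (hterm i).1.const_mul C
  have hmeas : AEStronglyMeasurable (fun x => ∑ i, |fderiv ℝ φ x (b i) * ⟪fderiv ℝ (d.u τ) x (b i), d.u τ x⟫|) volume := by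
    refine Finset.aestronglyMeasurable_fun_sum _ fun i _ => ?_
    have h1 : AEStronglyMeasurable (fun x => fderiv ℝ φ x (b i)) volume :=
      (measurable_fderiv_apply_const ℝ φ (b i)).aestronglyMeasurable
    have h2 : AEStronglyMeasurable (fun x => fderiv ℝ φ x (b i) * ⟪fderiv ℝ (d.u τ) x (b i), d.u τ x⟫) volume :=
      h1.mul (((hDuc.clm_apply continuous_const).inner huc).aestronglyMeasurable)
    exact h2.norm.congr (Eventually.of_forall fun x => by simp only [Real.norm_eq_abs])
  have hint : Integrable (fun x => ∑ i, |fderiv ℝ φ x (b i) * ⟪fderiv ℝ (d.u τ) x (b i), d.u τ x⟫|) volume :=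
    hsumint.mono' hmeas (Eventually.of_forall fun x => by
      rw [Real.norm_of_nonneg (Finset.sum_nonneg fun i _ => abs_nonneg _)]
      exact Finset.sum_le_sum fun i _ => hpt x i)
  refine ⟨hint, ?_⟩
  calc ∫ x, ∑ i, |fderiv ℝ φ x (b i) * ⟪fderiv ℝ (d.u τ) x (b i), d.u τ x⟫|
      ≤ ∫ x, ∑ i, C * (‖fderiv ℝ (d.u τ) x (b i)‖ * ‖d.u τ x‖) :=
        integral_mono hint hsumint fun x => Finset.sum_le_sum fun i _ => hpt x i
    _ = ∑ i, C * ∫ x, ‖fderiv ℝ (d.u τ) x (b i)‖ * ‖d.u τ x‖ := by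
        rw [integral_finsetSum _ fun i _ => (hterm i).1.const_mul C]
        refine Finset.sum_congr rfl fun i _ => ?_
        exact integral_const_mul _ _
    _ ≤ ∑ _i : Fin (Module.finrank ℝ E3), C * (Real.sqrt (d.Fd τ) * Real.sqrt (d.E2 τ)) :=
        Finset.sum_le_sum fun i _ => mul_le_mul_of_nonneg_left (hterm i).2 hC0
    _ = 3 * C * (Real.sqrt (d.Fd τ) * Real.sqrt (d.E2 τ)) := by rw [Finset.sum_const, hcard, nsmul_eq_mul]; ring

/-! ### The pressure term: `‖p(τ)‖_{L²} ≤ 9 ‖u(τ)‖₄²` by Plancherel -/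

/-- The pressure slice is continuous. [folklore] -/
theorem continuous_p {τ : ℝ} (hτ : τ ∈ Icc 0 d.T) : Continuous (d.p τ) := by
  have h := d.smooth_p.continuousOn.comp_continuous (f := fun x : E3 => ((τ, x) : ℝ × E3))
    (continuous_const.prodMk continuous_id) fun x => mk_mem_prod hτ (mem_univ x)
  simpa only [Function.comp_def, Function.uncurry_apply_pair] using h

/-- The convolution pieces `C_{jk} = (m V_j) ⋆ V_k` of the pressure symbol: integrable, square
integrable, with `𝓕 C_{jk} = JU_j · U_k`, hence (Plancherel)
`‖C_{jk}‖_{L²} = ‖JU_j U_k‖_{L²} ≤ (∫ ‖Ju‖² ‖u‖²)^{1/2}`. [folklore] -/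
theorem eLpNorm_fconv_piece_le (hm : d.m = msymbol χ) {τ : ℝ} (hτ : τ ∈ Icc 0 d.T) (j k : Fin 3) :
    Integrable (fconv (fun η => (d.m η : ℂ) * d.V τ η j) (fun η => d.V τ η k)) volume ∧
    MemLp (fconv (fun η => (d.m η : ℂ) * d.V τ η j) (fun η => d.V τ η k)) 2 volume ∧
    eLpNorm (fconv (fun η => (d.m η : ℂ) * d.V τ η j) (fun η => d.V τ η k)) 2 volume ≤
      ENNReal.ofReal (Real.sqrt (∫ x, ‖d.u τ x‖ ^ 4)) := by
  set f : E3 → ℂ := fun η => (d.m η : ℂ) * d.V τ η j with hf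
  set g : E3 → ℂ := fun η => d.V τ η k with hg
  have hfi : Integrable f volume := d.integrable_mV hτ j
  have hgi : Integrable g volume := d.integrable_V hτ k
  have hfm : Measurable f := (Complex.measurable_ofReal.comp d.hm.measurable).mul (measurable_pi_iff.1 (d.measurable_V τ) j)
  have hgm : Measurable g := measurable_pi_iff.1 (d.measurable_V τ) k
  have hCi : Integrable (fconv f g) volume := integrable_fconv hfi hgi
  -- `C ∈ L²` by the weighted Young inequality at weight `0`
  have hC2 : MemLp (fconv f g) 2 volume := by
    refine ⟨hCi.aestronglyMeasurable, ?_⟩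
    have hY := eLpNorm_wfun_fconv_le hfm hgm 0
    simp only [wfun_zero] at hY
    refine hY.trans_lt (ENNReal.mul_lt_top ?_ (d.memLp_V hτ k).eLpNorm_lt_top)
    exact (memLp_one_iff_integrable.2 hfi).eLpNorm_lt_top
  refine ⟨hCi, hC2, ?_⟩
  -- Plancherel and `𝓕 C = JU_j U_k`
  have hP : eLpNorm (𝓕 (fconv f g)) 2 volume = eLpNorm (fconv f g) 2 volume := eLpNorm_fourierIntegral_eq hCi hC2
  have hprod : 𝓕 (fconv f g) = fun x => d.JU τ x j * d.U τ x k := by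
    funext x
    rw [← fourier_mul_fourier' hfi hgi x]
    rfl
  rw [← hP, hprod]
  -- pointwise `‖JU_j U_k‖ ≤ ‖Ju‖ ‖u‖`, then the `L²` norm of the real majorant
  obtain ⟨hint, hle⟩ := d.integral_norm_ju_sq_mul_norm_sq_le χ hm hτ
  have hpt : ∀ x, ‖d.JU τ x j * d.U τ x k‖ ≤ ‖d.ju τ x‖ * ‖d.u τ x‖ := by
    intro x
    rw [norm_mul, ← d.ofReal_ju_apply, ← d.ofReal_u_apply, Complex.norm_real, Complex.norm_real, Real.norm_eq_abs,
      Real.norm_eq_abs]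
    exact mul_le_mul (abs_apply_le_norm (d.ju τ x) j) (abs_apply_le_norm (d.u τ x) k) (abs_nonneg _) (norm_nonneg _)
  have h0 : 0 ≤ ∫ x, ‖d.u τ x‖ ^ 4 := integral_nonneg fun x => by positivity
  calc eLpNorm (fun x => d.JU τ x j * d.U τ x k) 2 volume ≤ eLpNorm (fun x => ‖d.ju τ x‖ * ‖d.u τ x‖) 2 volume :=
        eLpNorm_mono_real hpt
    _ = (∫⁻ x, ENNReal.ofReal (‖d.ju τ x‖ ^ 2 * ‖d.u τ x‖ ^ 2)) ^ (1 / 2 : ℝ) := by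
        rw [eLpNorm_eq_lintegral_rpow_enorm_toReal two_ne_zero ENNReal.ofNat_ne_top, ENNReal.toReal_ofNat]
        congr 1
        refine lintegral_congr fun x => ?_
        rw [Real.enorm_eq_ofReal (by positivity), ENNReal.ofReal_rpow_of_nonneg (by positivity) (by norm_num)]
        congr 1
        rw [show (2 : ℝ) = (2 : ℕ) by norm_num, Real.rpow_natCast]; ring
    _ = (ENNReal.ofReal (∫ x, ‖d.ju τ x‖ ^ 2 * ‖d.u τ x‖ ^ 2)) ^ (1 / 2 : ℝ) := by
        rw [ofReal_integral_eq_lintegral_ofReal hint (Eventually.of_forall fun x => by positivity)]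
    _ ≤ (ENNReal.ofReal (∫ x, ‖d.u τ x‖ ^ 4)) ^ (1 / 2 : ℝ) := by gcongr
    _ = ENNReal.ofReal (Real.sqrt (∫ x, ‖d.u τ x‖ ^ 4)) := by
        rw [ENNReal.ofReal_rpow_of_nonneg h0 (by norm_num), Real.sqrt_eq_rpow]

omit d in
/-- `eLpNorm` of a finite sum of functions, pointwise form. [folklore] -/
theorem eLpNorm_fun_sum_le {α β : Type*} [MeasurableSpace α] {μ : Measure α} (s : Finset β) {f : β → α → ℝ}
    (hf : ∀ b ∈ s, AEStronglyMeasurable (f b) μ) :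
    eLpNorm (fun x => ∑ b ∈ s, f b x) 2 μ ≤ ∑ b ∈ s, eLpNorm (f b) 2 μ := by
  have h := eLpNorm_sum_le hf one_le_two (p := 2)
  have e : (∑ b ∈ s, f b) = fun x => ∑ b ∈ s, f b x := by funext x; simp only [Finset.sum_apply]
  rwa [e] at h

/-- **The `L²` bound of the pressure symbol**: `‖q(τ)‖_{L²} ≤ 9 ‖u(τ)‖₄²`
(`|ξⱼξₖ/‖ξ‖²| ≤ 1`, the triangle inequality over the nine pieces, Plancherel). [folklore] -/
theorem eLpNorm_q_le (hm : d.m = msymbol χ) {τ : ℝ} (hτ : τ ∈ Icc 0 d.T) :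
    eLpNorm (d.q τ) 2 volume ≤ 9 * ENNReal.ofReal (Real.sqrt (∫ x, ‖d.u τ x‖ ^ 4)) := by
  set C : Fin 3 → Fin 3 → E3 → ℂ := fun j k => fconv (fun η => (d.m η : ℂ) * d.V τ η j) (fun η => d.V τ η k) with hC
  have hpt : ∀ ξ, ‖d.q τ ξ‖ ≤ ‖∑ j, ∑ k, ‖C j k ξ‖‖ := by
    intro ξ
    rw [Real.norm_of_nonneg (Finset.sum_nonneg fun j _ => Finset.sum_nonneg fun k _ => norm_nonneg _)]
    change ‖presSymbol (vmul d.m (d.V τ)) (d.V τ) ξ‖ ≤ _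
    rw [presSymbol, norm_neg]
    refine (norm_sum_le _ _).trans (Finset.sum_le_sum fun j _ => (norm_sum_le _ _).trans (Finset.sum_le_sum fun k _ => ?_))
    rw [norm_mul, Complex.norm_real, Real.norm_eq_abs]
    calc |ξ j * ξ k / ‖ξ‖ ^ 2| * ‖fconv (vmul d.m (d.V τ) · j) (d.V τ · k) ξ‖ ≤ 1 * ‖C j k ξ‖ :=
          mul_le_mul_of_nonneg_right (abs_mul_div_norm_sq_le_one j k ξ) (norm_nonneg _)
      _ = ‖C j k ξ‖ := one_mul _
  have hmeas : ∀ j k, AEStronglyMeasurable (C j k) volume := fun j k => (d.eLpNorm_fconv_piece_le χ hm hτ j k).1.aestronglyMeasurable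
  calc eLpNorm (d.q τ) 2 volume ≤ eLpNorm (fun ξ => ∑ j, ∑ k, ‖C j k ξ‖) 2 volume := eLpNorm_mono hpt
    _ ≤ ∑ j, eLpNorm (fun ξ => ∑ k, ‖C j k ξ‖) 2 volume :=
        eLpNorm_fun_sum_le _ fun j _ => Finset.aestronglyMeasurable_fun_sum _ fun k _ => (hmeas j k).norm
    _ ≤ ∑ j, ∑ k, eLpNorm (fun ξ => ‖C j k ξ‖) 2 volume :=
        Finset.sum_le_sum fun j _ => eLpNorm_fun_sum_le _ fun k _ => (hmeas j k).norm
    _ ≤ ∑ _j : Fin 3, ∑ _k : Fin 3, ENNReal.ofReal (Real.sqrt (∫ x, ‖d.u τ x‖ ^ 4)) :=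
        Finset.sum_le_sum fun j _ => Finset.sum_le_sum fun k _ => by
          rw [eLpNorm_norm]; exact (d.eLpNorm_fconv_piece_le χ hm hτ j k).2.2
    _ = 9 * ENNReal.ofReal (Real.sqrt (∫ x, ‖d.u τ x‖ ^ 4)) := by
        simp only [Finset.sum_const, Finset.card_univ, Fintype.card_fin, nsmul_eq_mul]; push_cast; ring

/-- **The `L²` bound of the pressure**: `∫ p(τ)² ≤ 81 ∫ ‖u(τ)‖⁴` (`p = Re 𝓕q`, Plancherel). [folklore] -/
theorem integral_p_sq_le (hm : d.m = msymbol χ) {τ : ℝ} (hτ : τ ∈ Icc 0 d.T) :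
    Integrable (fun x => d.p τ x ^ 2) volume ∧ ∫ x, d.p τ x ^ 2 ≤ 81 * ∫ x, ‖d.u τ x‖ ^ 4 := by
  obtain ⟨B, hB⟩ := d.decay_q d.K₀
  obtain ⟨hdec, haesm⟩ := hB τ hτ
  have hqi : Integrable (d.q τ) volume := hdec.integrable (finrank_lt_of_card_lt d.hK₀) haesm
  have hq2 : MemLp (d.q τ) 2 volume := memLp_two_of_bound hqi fun ξ => hdec.norm_le ξ
  have hP2 : MemLp (d.P τ) 2 volume := by
    have := memLp_two_fourierIntegral hqi hq2; exact this
  have hPl : eLpNorm (d.P τ) 2 volume = eLpNorm (d.q τ) 2 volume := eLpNorm_fourierIntegral_eq hqi hq2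
  have hP2i : Integrable (fun x => ‖d.P τ x‖ ^ 2) volume := IsRegMild.integrable_normSq_of_memLp hP2
  have hpt : ∀ x, d.p τ x ^ 2 ≤ ‖d.P τ x‖ ^ 2 := fun x => by
    rw [RegSetup.p, ← sq_abs]
    exact pow_le_pow_left₀ (abs_nonneg _) (Complex.abs_re_le_norm _) 2
  have hpi : Integrable (fun x => d.p τ x ^ 2) volume :=
    hP2i.mono' ((d.continuous_p hτ).pow 2).aestronglyMeasurable (Eventually.of_forall fun x => by
      rw [Real.norm_of_nonneg (sq_nonneg _)]; exact hpt x)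
  refine ⟨hpi, ?_⟩
  have h0 : 0 ≤ ∫ x, ‖d.u τ x‖ ^ 4 := integral_nonneg fun x => by positivity
  have hreal : (eLpNorm (d.P τ) 2 volume).toReal ≤ 9 * Real.sqrt (∫ x, ‖d.u τ x‖ ^ 4) := by
    have h := hPl.trans_le (d.eLpNorm_q_le χ hm hτ)
    have h' := ENNReal.toReal_mono (by simp [ENNReal.mul_eq_top]) h
    rwa [ENNReal.toReal_mul, ENNReal.toReal_ofReal (Real.sqrt_nonneg _), show ((9 : ℝ≥0∞)).toReal = 9 by norm_num] at h'
  calc ∫ x, d.p τ x ^ 2 ≤ ∫ x, ‖d.P τ x‖ ^ 2 := integral_mono hpi hP2i hpt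
    _ = (eLpNorm (d.P τ) 2 volume).toReal ^ 2 := by
        rw [integral_norm_sq_eq_toReal hP2, ENNReal.toReal_pow]
    _ ≤ (9 * Real.sqrt (∫ x, ‖d.u τ x‖ ^ 4)) ^ 2 := pow_le_pow_left₀ ENNReal.toReal_nonneg hreal 2
    _ = 81 * ∫ x, ‖d.u τ x‖ ^ 4 := by rw [mul_pow, Real.sq_sqrt h0]; norm_num

/-- **The pressure slice bound**: `∫ |p(τ)| ‖u(τ)‖ ≤ 9 (∫‖u‖⁴)^{1/2} E₂(τ)^{1/2}`. [folklore] -/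
theorem integral_abs_p_mul_norm_le (hm : d.m = msymbol χ) {τ : ℝ} (hτ : τ ∈ Icc 0 d.T) :
    Integrable (fun x => |d.p τ x| * ‖d.u τ x‖) volume ∧
      ∫ x, |d.p τ x| * ‖d.u τ x‖ ≤ 9 * Real.sqrt (∫ x, ‖d.u τ x‖ ^ 4) * Real.sqrt (d.E2 τ) := by
  obtain ⟨hpi, hple⟩ := d.integral_p_sq_le χ hm hτ
  have hu2 : Integrable (fun x => ‖d.u τ x‖ ^ 2) volume := IsRegMild.integrable_normSq_of_memLp (d.memLp_u hτ)
  have hpc := d.continuous_p hτ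
  have huc := d.continuous_u hτ
  have hint : Integrable (fun x => |d.p τ x| * ‖d.u τ x‖) volume := by
    refine ((hpi.add hu2).div_const 2).mono' (hpc.abs.mul huc.norm).aestronglyMeasurable (Eventually.of_forall fun x => ?_)
    rw [Real.norm_of_nonneg (by positivity)]
    have := two_mul_le_add_sq (|d.p τ x|) ‖d.u τ x‖
    change |d.p τ x| * ‖d.u τ x‖ ≤ (d.p τ x ^ 2 + ‖d.u τ x‖ ^ 2) / 2
    rw [← sq_abs (d.p τ x)]; linarith
  refine ⟨hint, ?_⟩
  have hCS := integral_mul_le_sqrt_mul_sqrt (μ := volume) (f := fun x => |d.p τ x|) (g := fun x => ‖d.u τ x‖)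
    (fun x => abs_nonneg _) (fun x => norm_nonneg _) hpc.abs.aestronglyMeasurable huc.norm.aestronglyMeasurable
    (hpi.congr (Eventually.of_forall fun x => (sq_abs _).symm)) hu2
  refine hCS.trans (mul_le_mul_of_nonneg_right ?_ (Real.sqrt_nonneg _))
  have h0 : 0 ≤ ∫ x, ‖d.u τ x‖ ^ 4 := integral_nonneg fun x => by positivity
  calc Real.sqrt (∫ x, |d.p τ x| ^ 2) = Real.sqrt (∫ x, d.p τ x ^ 2) := by
        congr 1; exact integral_congr_ae (Eventually.of_forall fun x => sq_abs _)
    _ ≤ Real.sqrt (81 * ∫ x, ‖d.u τ x‖ ^ 4) := Real.sqrt_le_sqrt hple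
    _ = 9 * Real.sqrt (∫ x, ‖d.u τ x‖ ^ 4) := by
        rw [Real.sqrt_mul (by norm_num), show (81 : ℝ) = 9 ^ 2 by norm_num, Real.sqrt_sq (by norm_num)]

/-! ### Energy bookkeeping: `E₂(t) + 2ν ∫₀ᵗ F = E₂(0)` -/

/-- The dissipated energy `D_all(t) = ∫_{(0,t)} F`. [folklore] -/
def Dall (t : ℝ) : ℝ := ∫ τ in Ioo 0 t, d.Fd τ

/-- `F(τ) = 4π² D(τ)` on `[0, T]`. [folklore] -/
theorem Fd_eq {τ : ℝ} (hτ : τ ∈ Icc 0 d.T) : d.Fd τ = 4 * π ^ 2 * d.D τ := (d.integral_frobeniusNormSq_fderiv_u hτ).2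

/-- `F` is integrable on `(0, t)` for `t ≤ T`. [folklore] -/
theorem integrableOn_Fd {t : ℝ} (ht : t ≤ d.T) : IntegrableOn d.Fd (Ioo 0 t) volume := by
  have h : IntegrableOn (fun τ => 4 * π ^ 2 * d.D τ) (Ioo 0 t) volume :=
    ((d.integrableOn_D 0 t).mono_set Ioo_subset_Ioc_self).const_mul (4 * π ^ 2)
  exact h.congr_fun (fun τ hτ => (d.Fd_eq ⟨hτ.1.le, hτ.2.le.trans ht⟩).symm) measurableSet_Ioo

/-- `D_all(t) = (∫⁻∫⁻ |∇u|²).toReal`. [folklore] -/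
theorem Dall_eq {t : ℝ} (ht : t ∈ Icc 0 d.T) :
    d.Dall t = (∫⁻ τ in Ioo 0 t, ∫⁻ x, ENNReal.ofReal (frobeniusNormSq (fderiv ℝ (d.u τ) x))).toReal := by
  rw [d.lintegral_dissipation_eq le_rfl ht.1 ht.2, ENNReal.toReal_ofReal (mul_nonneg (by positivity)
    (intervalIntegral.integral_nonneg ht.1 fun τ _ => d.D_nonneg τ)), Dall, intervalIntegral.integral_of_le ht.1,
    integral_Ioc_eq_integral_Ioo, ← integral_const_mul]
  exact setIntegral_congr_fun measurableSet_Ioo fun τ hτ => d.Fd_eq ⟨hτ.1.le, hτ.2.le.trans ht.2⟩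

/-- **The energy equality in terms of `E₂` and `F`**: `E₂(t) + 2ν D_all(t) = E₂(0)`. [folklore] -/
theorem E2_add_Dall {t : ℝ} (ht : t ∈ Icc 0 d.T) : d.E2 t + 2 * d.ν * d.Dall t = d.E2 0 := by
  have h := d.energyEq le_rfl ht.1 ht.2
  rw [VectorCalculus.kineticEnergy, VectorCalculus.kineticEnergy, ← d.Dall_eq ht] at h
  unfold E2
  linarith

/-- `D_all ≥ 0`. [folklore] -/
theorem Dall_nonneg (t : ℝ) : 0 ≤ d.Dall t :=
  setIntegral_nonneg measurableSet_Ioo fun τ _ => d.Fd_nonneg τ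

/-- `E₂(t) ≤ E₂(0)` and `D_all(t) ≤ E₂(0)/(2ν)`. [folklore] -/
theorem E2_le_and_Dall_le {t : ℝ} (ht : t ∈ Icc 0 d.T) : d.E2 t ≤ d.E2 0 ∧ d.Dall t ≤ d.E2 0 / (2 * d.ν) := by
  have h := d.E2_add_Dall ht
  have hν := d.hν
  have hD := d.Dall_nonneg t
  have hE := d.E2_nonneg t
  refine ⟨by nlinarith, ?_⟩
  rw [le_div_iff₀ (by positivity)]
  nlinarith

/-! ### The cut-off and the fictitious force -/

omit d in
/-- The gradient constant `C₁` of the tree's cut-offs (`exists_norm_fderiv_taoCutoff_le`). [folklore] -/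
def Ccut : ℝ := (exists_norm_fderiv_taoCutoff_le (E := E3)).choose

omit d in
/-- `0 < C₁`. [folklore] -/
theorem Ccut_pos : 0 < Ccut := (exists_norm_fderiv_taoCutoff_le (E := E3)).choose_spec.1

omit d in
/-- `‖D(taoCutoff R r) x‖ ≤ C₁ / r`. [folklore] -/
theorem norm_fderiv_taoCutoff_le_Ccut {R r : ℝ} (hr : 0 < r) (hR : 0 < R) (x : E3) :
    ‖fderiv ℝ (taoCutoff R r) x‖ ≤ Ccut / r :=
  (exists_norm_fderiv_taoCutoff_le (E := E3)).choose_spec.2 R r hr hR x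

/-- **The fictitious force against a cut-off**: for `t ∈ [0, T]`, a `C¹` compactly supported `φ`,
`∫ φ ⟪f(t), u(t)⟫ = −½ ∫ (Dφ·u) ‖u‖² + ½ ∫ (Dφ·Ju) ‖u‖²`
(integration by parts with the transport fields `u` and `Ju`, both divergence free). [folklore] -/
theorem integral_cutoff_mul_inner_force {t : ℝ} (ht : t ∈ Icc 0 d.T) {φ : E3 → ℝ} (hφ : ContDiff ℝ 1 φ)
    (hc : HasCompactSupport φ) :
    ∫ x, φ x * ⟪d.force t x, d.u t x⟫ =
      -(2⁻¹ * ∫ x, fderiv ℝ φ x (d.u t x) * ‖d.u t x‖ ^ 2) + 2⁻¹ * ∫ x, fderiv ℝ φ x (d.ju t x) * ‖d.u t x‖ ^ 2 := by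
  have hu1 : ContDiff ℝ 1 (d.u t) := d.contDiff_u ht 1
  have hj1 : ContDiff ℝ 1 (d.ju t) := d.contDiff_ju ht 1
  have huc := hu1.continuous
  have hjc := hj1.continuous
  have hDuc : Continuous (fderiv ℝ (d.u t)) := hu1.continuous_fderiv one_ne_zero
  have hφc := hφ.continuous
  have hDφc : Continuous (fderiv ℝ φ) := hφ.continuous_fderiv one_ne_zero
  have hcDφ : HasCompactSupport (fderiv ℝ φ) := hc.fderiv (𝕜 := ℝ)
  set w : E3 → E3 := fun x => φ x • d.u t x with hw
  have hw1 : ContDiff ℝ 1 w := hφ.smul hu1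
  have hcw : HasCompactSupport w := hc.smul_right
  -- the identity for a divergence-free transport field `W`
  have key : ∀ {W : E3 → E3}, ContDiff ℝ 1 W → (∀ x, VectorCalculus.divergence W x = 0) →
      ∫ x, φ x * ⟪convect W (d.u t) x, d.u t x⟫ = -(2⁻¹ * ∫ x, fderiv ℝ φ x (W x) * ‖d.u t x‖ ^ 2) := by
    intro W hW hdivW
    have hWc := hW.continuous
    have h0 := integral_inner_convect_add_eq_zero hW hu1 hw1 hcw
    have hz : ∫ x, VectorCalculus.divergence W x * ⟪d.u t x, w x⟫ = 0 := by simp [hdivW]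
    have hA : ∫ x, ⟪convect W (d.u t) x, w x⟫ = ∫ x, φ x * ⟪convect W (d.u t) x, d.u t x⟫ :=
      integral_congr_ae (Eventually.of_forall fun x => by simp only [hw, real_inner_smul_right])
    have hCw : ∀ x, convect W w x = φ x • convect W (d.u t) x + (fderiv ℝ φ x (W x)) • d.u t x := fun x =>
      convect_smul_apply (hφ.differentiable one_ne_zero x) (hu1.differentiable one_ne_zero x)
    have iA : Integrable (fun x => φ x * ⟪d.u t x, convect W (d.u t) x⟫) (volume : Measure E3) :=
      (hφc.mul (huc.inner (hDuc.clm_apply hWc))).integrable_of_hasCompactSupport hc.mul_right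
    have iB : Integrable (fun x => fderiv ℝ φ x (W x) * ‖d.u t x‖ ^ 2) (volume : Measure E3) :=
      ((hDφc.clm_apply hWc).mul (huc.norm.pow 2)).integrable_of_hasCompactSupport
        ((hcDφ.mono fun x hx => by contrapose! hx; simp_all).mul_right)
    have hB : ∫ x, ⟪d.u t x, convect W w x⟫ = (∫ x, φ x * ⟪d.u t x, convect W (d.u t) x⟫) +
        ∫ x, fderiv ℝ φ x (W x) * ‖d.u t x‖ ^ 2 := by
      rw [← integral_add iA iB]
      refine integral_congr_ae (Eventually.of_forall fun x => ?_)
      simp only [hCw, inner_add_right, real_inner_smul_right, real_inner_self_eq_norm_sq]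
    have hcomm : ∫ x, φ x * ⟪d.u t x, convect W (d.u t) x⟫ = ∫ x, φ x * ⟪convect W (d.u t) x, d.u t x⟫ :=
      integral_congr_ae (Eventually.of_forall fun x => by dsimp only; rw [real_inner_comm])
    rw [hA, hB, hz, hcomm] at h0
    linarith
  have e1 := key hu1 fun x => d.isDivFree_u ht x
  have e2 := key hj1 fun x => d.isDivFree_ju ht x
  -- split the force
  have i1 : Integrable (fun x => φ x * ⟪convect (d.u t) (d.u t) x, d.u t x⟫) (volume : Measure E3) :=
    (hφc.mul ((hDuc.clm_apply huc).inner huc)).integrable_of_hasCompactSupport hc.mul_right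
  have i2 : Integrable (fun x => φ x * ⟪convect (d.ju t) (d.u t) x, d.u t x⟫) (volume : Measure E3) :=
    (hφc.mul ((hDuc.clm_apply hjc).inner huc)).integrable_of_hasCompactSupport hc.mul_right
  have hsplit : ∫ x, φ x * ⟪d.force t x, d.u t x⟫ =
      (∫ x, φ x * ⟪convect (d.u t) (d.u t) x, d.u t x⟫) - ∫ x, φ x * ⟪convect (d.ju t) (d.u t) x, d.u t x⟫ := by
    rw [← integral_sub i1 i2]
    refine integral_congr_ae (Eventually.of_forall fun x => ?_)
    simp only [RegSetup.force, inner_sub_left, mul_sub]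
  rw [hsplit, e1, e2]
  ring

/-! ### Time slices of the cut-off terms are integrable in `τ` -/

/-- Joint continuity of `u`, `Ju`, `∇u` on the closed slab. [folklore] -/
theorem continuousOn_slab :
    ContinuousOn (fun z : ℝ × E3 => d.u z.1 z.2) (Icc 0 d.T ×ˢ univ) ∧
    ContinuousOn (fun z : ℝ × E3 => d.ju z.1 z.2) (Icc 0 d.T ×ˢ univ) ∧
    ContinuousOn (fun z : ℝ × E3 => fderiv ℝ (d.u z.1) z.2) (Icc 0 d.T ×ˢ univ) :=
  ⟨d.smooth_u.continuousOn, d.smooth_ju.continuousOn,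
    (d.smooth_u.fderiv_slice (uniqueDiffOn_Icc d.hT)).continuousOn⟩

/-- **Slices of a compactly supported jointly continuous integrand are integrable in time.** [folklore] -/
theorem integrableOn_slice {G : ℝ × E3 → ℝ} {s t : ℝ} (hs : 0 ≤ s) (ht : t ≤ d.T) {K : Set E3} (hK : IsCompact K)
    (hG : ContinuousOn G (Icc 0 d.T ×ˢ univ)) (hGK : ∀ τ ∈ Icc s t, ∀ x ∉ K, G (τ, x) = 0) :
    IntegrableOn (fun τ => ∫ x, G (τ, x)) (Ioo s t) volume := by
  have hsub : Icc s t ×ˢ (univ : Set E3) ⊆ Icc 0 d.T ×ˢ univ := prod_mono (Icc_subset_Icc hs ht) Subset.rfl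
  have h := integrable_prod_of_continuousOn hK (hG.mono hsub) hGK
  exact h.integral_prod_left

/-- The transport slices `τ ↦ ∫ (Dφ·W(τ)) ‖u(τ)‖²`, `W ∈ {u, Ju}`, are integrable on `(s, t)`. [folklore] -/
theorem integrableOn_transport_slice {φ : E3 → ℝ} (hφ : ContDiff ℝ 1 φ) (hc : HasCompactSupport φ) {s t : ℝ}
    (hs : 0 ≤ s) (ht : t ≤ d.T) :
    IntegrableOn (fun τ => ∫ x, fderiv ℝ φ x (d.u τ x) * ‖d.u τ x‖ ^ 2) (Ioo s t) volume ∧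
    IntegrableOn (fun τ => ∫ x, fderiv ℝ φ x (d.ju τ x) * ‖d.u τ x‖ ^ 2) (Ioo s t) volume := by
  obtain ⟨cu, cj, -⟩ := d.continuousOn_slab
  have hDφc : Continuous (fderiv ℝ φ) := hφ.continuous_fderiv one_ne_zero
  have hK : IsCompact (tsupport (fderiv ℝ φ)) := hc.fderiv (𝕜 := ℝ)
  have hzero : ∀ x ∉ tsupport (fderiv ℝ φ), fderiv ℝ φ x = 0 := fun x hx => image_eq_zero_of_notMem_tsupport hx
  constructor
  · refine d.integrableOn_slice (G := fun z => fderiv ℝ φ z.2 (d.u z.1 z.2) * ‖d.u z.1 z.2‖ ^ 2) hs ht hK ?_ ?_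
    · exact ((hDφc.comp continuous_snd).continuousOn.clm_apply cu).mul (cu.norm.pow 2)
    · intro τ _ x hx; simp [hzero x hx]
  · refine d.integrableOn_slice (G := fun z => fderiv ℝ φ z.2 (d.ju z.1 z.2) * ‖d.u z.1 z.2‖ ^ 2) hs ht hK ?_ ?_
    · exact ((hDφc.comp continuous_snd).continuousOn.clm_apply cj).mul (cu.norm.pow 2)
    · intro τ _ x hx; simp [hzero x hx]

/-- The localised dissipation slice `τ ↦ ∫ φ |∇u(τ)|²` is integrable on `(s, t)`, and dominated by
`F(τ)` when `0 ≤ φ ≤ 1`. [folklore] -/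
theorem integrableOn_cutoff_dissipation_slice {φ : E3 → ℝ} (hφ : Continuous φ) (hc : HasCompactSupport φ)
    (h1 : ∀ x, φ x ≤ 1) {s t : ℝ} (hs : 0 ≤ s) (ht : t ≤ d.T) :
    IntegrableOn (fun τ => ∫ x, φ x * frobeniusNormSq (fderiv ℝ (d.u τ) x)) (Ioo s t) volume ∧
    ∀ τ ∈ Icc 0 d.T, ∫ x, φ x * frobeniusNormSq (fderiv ℝ (d.u τ) x) ≤ d.Fd τ := by
  obtain ⟨-, -, cDu⟩ := d.continuousOn_slab
  constructor
  · refine d.integrableOn_slice (G := fun z => φ z.2 * frobeniusNormSq (fderiv ℝ (d.u z.1) z.2)) hs ht hc.isCompact ?_ ?_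
    · exact (hφ.comp continuous_snd).continuousOn.mul (LerayHopfProofs.continuous_frobeniusNormSq.comp_continuousOn cDu)
    · intro τ _ x hx; simp [image_eq_zero_of_notMem_tsupport hx]
  · intro τ hτ
    obtain ⟨hi, -⟩ := d.integral_frobeniusNormSq_fderiv_u hτ
    have hfc : Continuous fun x => frobeniusNormSq (fderiv ℝ (d.u τ) x) :=
      LerayHopfProofs.continuous_frobeniusNormSq.comp ((d.contDiff_u hτ 1).continuous_fderiv one_ne_zero)
    have hic : Integrable (fun x => φ x * frobeniusNormSq (fderiv ℝ (d.u τ) x)) volume :=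
      (hφ.mul hfc).integrable_of_hasCompactSupport hc.mul_right
    refine integral_mono hic hi fun x => ?_
    have := frobeniusNormSq_nonneg (fderiv ℝ (d.u τ) x)
    calc φ x * frobeniusNormSq (fderiv ℝ (d.u τ) x) ≤ 1 * frobeniusNormSq (fderiv ℝ (d.u τ) x) := by gcongr; exact h1 x
      _ = _ := one_mul _

/-! ### The far-field energy inequality (exact combination) -/

/-- **The far-field energy, up to the three cut-off errors.** For `η = taoCutoff R₂ (R₂ − R₁)`,
`0 < R₁ < R₂`, `t ∈ [0, T]`:
`∫ (1−η)‖u(t)‖² ≤ ∫ (1−η)‖u(0)‖² + 2ν |∫∫ ∑ᵢ ∂ᵢη ⟪∂ᵢu, u⟫| + 2 |∫∫ p (Dη·u)| + |∫∫ (Dη·Ju) ‖u‖²|`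
(global energy equality minus the tree's localised balance for `η`; the transport parts of the
fictitious force recombine, the localised dissipation is dominated by the total one). [folklore] -/
theorem far_energy_le_errors {R₁ R₂ : ℝ} (hR₁ : 0 < R₁) (h12 : R₁ < R₂) {t : ℝ} (ht : t ∈ Icc 0 d.T) :
    ∫ x, (1 - taoCutoff R₂ (R₂ - R₁) x) * ‖d.u t x‖ ^ 2 ≤
      (∫ x, (1 - taoCutoff R₂ (R₂ - R₁) x) * ‖d.u 0 x‖ ^ 2)
      + 2 * d.ν * |∫ τ in Ioo 0 t, ∫ x, ∑ i, fderiv ℝ (taoCutoff R₂ (R₂ - R₁)) x (stdOrthonormalBasis ℝ E3 i) *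
          ⟪fderiv ℝ (d.u τ) x (stdOrthonormalBasis ℝ E3 i), d.u τ x⟫|
      + 2 * |∫ τ in Ioo 0 t, ∫ x, d.p τ x * fderiv ℝ (taoCutoff R₂ (R₂ - R₁)) x (d.u τ x)|
      + |∫ τ in Ioo 0 t, ∫ x, fderiv ℝ (taoCutoff R₂ (R₂ - R₁)) x (d.ju τ x) * ‖d.u τ x‖ ^ 2| := by
  set η : E3 → ℝ := taoCutoff R₂ (R₂ - R₁) with hηdef
  have hr : 0 < R₂ - R₁ := sub_pos.2 h12
  have hR₂ : 0 < R₂ := hR₁.trans h12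
  have hη1 : ContDiff ℝ 1 η := (contDiff_taoCutoff (n := 1) R₂ (R₂ - R₁))
  have hηc : HasCompactSupport η := hasCompactSupport_taoCutoff hR₂.le hr.le
  have hη0 : ∀ x, 0 ≤ η x := fun x => taoCutoff_nonneg _ _ x
  have hηle : ∀ x, η x ≤ 1 := fun x => taoCutoff_le_one _ _ x
  -- (1) the localised balance of the tree
  have hloc := d.isClassicalNSSolutionOn.energy_balance_cutoff d.hT hη1 hηc le_rfl ht.1 ht.2
  -- (2) the global energy equality
  have hglob := d.E2_add_Dall ht
  -- (3) the force term
  obtain ⟨iA, iJ⟩ := d.integrableOn_transport_slice hη1 hηc le_rfl ht.2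
  have hforce : ∫ τ in Ioo 0 t, ∫ x, η x * ⟪d.force τ x, d.u τ x⟫ =
      -(2⁻¹ * ∫ τ in Ioo 0 t, ∫ x, fderiv ℝ η x (d.u τ x) * ‖d.u τ x‖ ^ 2) +
        2⁻¹ * ∫ τ in Ioo 0 t, ∫ x, fderiv ℝ η x (d.ju τ x) * ‖d.u τ x‖ ^ 2 := by
    have i1 : IntegrableOn (fun τ => -(2⁻¹ * ∫ x, fderiv ℝ η x (d.u τ x) * ‖d.u τ x‖ ^ 2)) (Ioo 0 t) volume :=
      (iA.const_mul 2⁻¹).neg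
    have i2 : IntegrableOn (fun τ => 2⁻¹ * ∫ x, fderiv ℝ η x (d.ju τ x) * ‖d.u τ x‖ ^ 2) (Ioo 0 t) volume :=
      iJ.const_mul 2⁻¹
    rw [setIntegral_congr_fun measurableSet_Ioo (fun τ hτ => d.integral_cutoff_mul_inner_force
      ⟨hτ.1.le, hτ.2.le.trans ht.2⟩ hη1 hηc), integral_add i1 i2, integral_neg, integral_const_mul, integral_const_mul]
  -- (4) the localised dissipation is at most the total one
  obtain ⟨iF, hFle⟩ := d.integrableOn_cutoff_dissipation_slice (continuous_taoCutoff _ _) hηc hηle le_rfl ht.2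
  have hdiss : ∫ τ in Ioo 0 t, ∫ x, η x * frobeniusNormSq (fderiv ℝ (d.u τ) x) ≤ d.Dall t := by
    rw [Dall]
    refine setIntegral_mono_on iF (d.integrableOn_Fd ht.2) measurableSet_Ioo fun τ hτ => ?_
    exact hFle τ ⟨hτ.1.le, hτ.2.le.trans ht.2⟩
  -- (5) `∫ (1 - η) ‖u‖² = E₂ - ∫ η ‖u‖²` at the two times
  have hsplit : ∀ {s}, s ∈ Icc 0 d.T → ∫ x, (1 - η x) * ‖d.u s x‖ ^ 2 = d.E2 s - ∫ x, η x * ‖d.u s x‖ ^ 2 := by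
    intro s hs
    have hu2 : Integrable (fun x => ‖d.u s x‖ ^ 2) volume := IsRegMild.integrable_normSq_of_memLp (d.memLp_u hs)
    have hη2 : Integrable (fun x => η x * ‖d.u s x‖ ^ 2) volume :=
      ((continuous_taoCutoff _ _).mul ((d.continuous_u hs).norm.pow 2)).integrable_of_hasCompactSupport hηc.mul_right
    rw [E2, ← integral_sub hu2 hη2]
    exact integral_congr_ae (Eventually.of_forall fun x => by ring)
  rw [hsplit ht, hsplit ⟨le_rfl, d.hT.le⟩]
  rw [hforce] at hloc
  -- (6) combine: every remaining error is bounded by its absolute value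
  have hν := d.hν
  have habs1 := le_abs_self (∫ τ in Ioo 0 t, ∫ x, ∑ i, fderiv ℝ η x (stdOrthonormalBasis ℝ E3 i) *
          ⟪fderiv ℝ (d.u τ) x (stdOrthonormalBasis ℝ E3 i), d.u τ x⟫)
  have habs2 := neg_abs_le (∫ τ in Ioo 0 t, ∫ x, d.p τ x * fderiv ℝ η x (d.u τ x))
  have habs3 := neg_abs_le (∫ τ in Ioo 0 t, ∫ x, fderiv ℝ η x (d.ju τ x) * ‖d.u τ x‖ ^ 2)
  nlinarith [hdiss, hloc, hglob, habs1, habs2, habs3, d.Dall_nonneg t]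

/-! ### Hölder in time against the dissipation -/

/-- `F^θ` is integrable on `(0, t)` for `0 < θ ≤ 1` (`x^θ ≤ 1 + x`). [folklore] -/
theorem integrableOn_Fd_rpow {t : ℝ} (ht : t ≤ d.T) {θ : ℝ} (hθ0 : 0 < θ) (hθ1 : θ ≤ 1) :
    IntegrableOn (fun τ => d.Fd τ ^ θ) (Ioo 0 t) volume := by
  have hF := d.integrableOn_Fd ht
  have hbound : IntegrableOn (fun τ => 1 + d.Fd τ) (Ioo 0 t) volume := (integrableOn_const (by simp)).add hF
  refine hbound.mono' (hF.aestronglyMeasurable.aemeasurable.pow_const θ).aestronglyMeasurable ?_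
  refine ae_of_all _ fun τ => ?_
  have h0 := d.Fd_nonneg τ
  rw [Real.norm_of_nonneg (Real.rpow_nonneg h0 θ)]
  rcases le_total (d.Fd τ) 1 with h | h
  · exact (Real.rpow_le_one h0 h hθ0.le).trans (by linarith)
  · calc d.Fd τ ^ θ ≤ d.Fd τ ^ (1 : ℝ) := Real.rpow_le_rpow_of_exponent_le h hθ1
      _ = d.Fd τ := Real.rpow_one _
      _ ≤ 1 + d.Fd τ := by linarith

/-- **Hölder in time**: `∫_{(0,t)} F^{1/q} ≤ t^{1/p} D_all(t)^{1/q}` for conjugate exponents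
`p, q` (applied with `q = 2` and `q = 4/3`). [folklore] -/
theorem integral_Fd_rpow_le {t : ℝ} (ht : t ∈ Icc 0 d.T) {p q : ℝ} (hpq : p.HolderConjugate q) :
    ∫ τ in Ioo 0 t, d.Fd τ ^ (1 / q) ≤ t ^ (1 / p) * d.Dall t ^ (1 / q) := by
  have hp : 1 < p := (Real.holderConjugate_iff.1 hpq).1
  have hq : 1 < q := (Real.holderConjugate_iff.1 hpq.symm).1
  have hq0 : 0 < q := by linarith
  have hp0 : 0 < p := by linarith
  set μ : Measure ℝ := volume.restrict (Ioo 0 t) with hμ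
  haveI : IsFiniteMeasure μ := by
    rw [hμ]; exact ⟨by rw [Measure.restrict_apply_univ, Real.volume_Ioo]; exact ENNReal.ofReal_lt_top⟩
  have hF := d.integrableOn_Fd ht.2
  have hg : MemLp (fun τ => d.Fd τ ^ (1 / q)) (ENNReal.ofReal q) μ := by
    have haesm : AEStronglyMeasurable (fun τ => d.Fd τ ^ (1 / q)) μ :=
      (hF.aestronglyMeasurable.aemeasurable.pow_const _).aestronglyMeasurable
    refine (integrable_norm_rpow_iff haesm (by simp [hq0]) ENNReal.ofReal_ne_top).1 ?_
    rw [ENNReal.toReal_ofReal hq0.le]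
    refine hF.congr (ae_of_all _ fun τ => ?_)
    have h0 := d.Fd_nonneg τ
    show d.Fd τ = ‖d.Fd τ ^ (1 / q)‖ ^ q
    rw [Real.norm_of_nonneg (Real.rpow_nonneg h0 _), ← Real.rpow_mul h0, one_div, inv_mul_cancel₀ hq0.ne', Real.rpow_one]
  have h1 : MemLp (fun _ : ℝ => (1 : ℝ)) (ENNReal.ofReal p) μ := memLp_const 1
  have hH := integral_mul_le_Lp_mul_Lq_of_nonneg (μ := μ) hpq (ae_of_all _ fun τ => zero_le_one)
    (ae_of_all _ fun τ => Real.rpow_nonneg (d.Fd_nonneg τ) _) h1 hg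
  simp only [one_mul, Real.one_rpow, integral_const, smul_eq_mul, mul_one] at hH
  refine hH.trans (le_of_eq ?_)
  congr 1
  · rw [Measure.real, hμ, Measure.restrict_apply_univ, Real.volume_Ioo, sub_zero, ENNReal.toReal_ofReal ht.1]
  · rw [Dall]
    congr 1
    refine integral_congr_ae (ae_of_all _ fun τ => ?_)
    have h0 := d.Fd_nonneg τ
    show (d.Fd τ ^ (1 / q)) ^ q = d.Fd τ
    rw [← Real.rpow_mul h0, one_div, inv_mul_cancel₀ hq0.ne', Real.rpow_one]

/-- `∫_{(0,t)} F^{1/2} ≤ t^{1/2} D_all^{1/2}`. [folklore] -/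
theorem integral_sqrt_Fd_le {t : ℝ} (ht : t ∈ Icc 0 d.T) :
    ∫ τ in Ioo 0 t, Real.sqrt (d.Fd τ) ≤ Real.sqrt t * Real.sqrt (d.Dall t) := by
  have h := d.integral_Fd_rpow_le ht Real.HolderConjugate.two_two
  simpa only [Real.sqrt_eq_rpow] using h

/-- `∫_{(0,t)} F^{3/4} ≤ t^{1/4} D_all^{3/4}`. [folklore] -/
theorem integral_Fd_rpow_three_quarters_le {t : ℝ} (ht : t ∈ Icc 0 d.T) :
    ∫ τ in Ioo 0 t, d.Fd τ ^ (3 / 4 : ℝ) ≤ t ^ (1 / 4 : ℝ) * d.Dall t ^ (3 / 4 : ℝ) := by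
  have h := d.integral_Fd_rpow_le ht (p := 4) (q := 4 / 3) (Real.holderConjugate_iff.2 ⟨by norm_num, by norm_num⟩)
  convert h using 2 <;> norm_num

/-! ### The three cut-off errors -/

section Errors

variable {R₁ R₂ M : ℝ} (hm : d.m = msymbol χ) (hR₁ : 0 < R₁) (h12 : R₁ < R₂) (hM : d.E2 0 ≤ M ^ 2) (hM0 : 0 ≤ M)
include hR₁ h12 hM hM0

omit hR₁ h12 in
/-- `√E₂(τ) ≤ M` on `[0, T]`. [folklore] -/
theorem sqrt_E2_le {τ : ℝ} (hτ : τ ∈ Icc 0 d.T) : Real.sqrt (d.E2 τ) ≤ M := by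
  have h := (d.E2_le_and_Dall_le hτ).1
  calc Real.sqrt (d.E2 τ) ≤ Real.sqrt (M ^ 2) := Real.sqrt_le_sqrt (h.trans hM)
    _ = M := Real.sqrt_sq hM0

omit hR₁ h12 in
/-- **The `L⁴` slice bound in terms of the dissipation**: `(∫‖u(τ)‖⁴)^{1/2} ≤ (M K³)^{1/2} F(τ)^{3/4}`. [folklore] -/
theorem sqrt_integral_norm_pow_four_le {τ : ℝ} (hτ : τ ∈ Icc 0 d.T) :
    Real.sqrt (∫ x, ‖d.u τ x‖ ^ 4) ≤ Real.sqrt (M * KS ^ 3) * d.Fd τ ^ (3 / 4 : ℝ) := by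
  have hF := d.Fd_nonneg τ
  have h4 := d.integral_norm_pow_four_u_le hτ
  have hE := d.sqrt_E2_le hM hM0 hτ
  calc Real.sqrt (∫ x, ‖d.u τ x‖ ^ 4) ≤ Real.sqrt (M * (KS ^ 3 * d.Fd τ ^ (3 / 2 : ℝ))) := by
        refine Real.sqrt_le_sqrt (h4.trans ?_)
        exact mul_le_mul_of_nonneg_right hE (by have := KS_nonneg; positivity)
    _ = Real.sqrt (M * KS ^ 3) * Real.sqrt (d.Fd τ ^ (3 / 2 : ℝ)) := by
        rw [← mul_assoc, Real.sqrt_mul (by have := KS_nonneg; positivity)]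
    _ = Real.sqrt (M * KS ^ 3) * d.Fd τ ^ (3 / 4 : ℝ) := by
        rw [Real.sqrt_eq_rpow (d.Fd τ ^ (3 / 2 : ℝ)), ← Real.rpow_mul hF]; norm_num

omit hM hM0 in
/-- **The viscous cross error**:
`|∫∫ ∑ᵢ ∂ᵢη ⟪∂ᵢu, u⟫| ≤ 3 (C₁/(R₂−R₁)) M t^{1/2} D_all(t)^{1/2}`. [folklore] -/
theorem abs_visc_error_le (hM : d.E2 0 ≤ M ^ 2) (hM0 : 0 ≤ M) {t : ℝ} (ht : t ∈ Icc 0 d.T) :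
    |∫ τ in Ioo 0 t, ∫ x, ∑ i, fderiv ℝ (taoCutoff R₂ (R₂ - R₁)) x (stdOrthonormalBasis ℝ E3 i) *
        ⟪fderiv ℝ (d.u τ) x (stdOrthonormalBasis ℝ E3 i), d.u τ x⟫| ≤
      3 * (Ccut / (R₂ - R₁)) * M * (Real.sqrt t * Real.sqrt (d.Dall t)) := by
  set η : E3 → ℝ := taoCutoff R₂ (R₂ - R₁) with hηdef
  have hr : 0 < R₂ - R₁ := sub_pos.2 h12
  have hR₂ : 0 < R₂ := hR₁.trans h12
  have hC : ∀ x, ‖fderiv ℝ η x‖ ≤ Ccut / (R₂ - R₁) := norm_fderiv_taoCutoff_le_Ccut hr hR₂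
  have hC0 : 0 ≤ Ccut / (R₂ - R₁) := div_nonneg Ccut_pos.le hr.le
  -- slice bound
  have hslice : ∀ τ ∈ Ioo 0 t, ‖∫ x, ∑ i, fderiv ℝ η x (stdOrthonormalBasis ℝ E3 i) *
      ⟪fderiv ℝ (d.u τ) x (stdOrthonormalBasis ℝ E3 i), d.u τ x⟫‖ ≤ 3 * (Ccut / (R₂ - R₁)) * M * Real.sqrt (d.Fd τ) := by
    intro τ hτ
    have hτI : τ ∈ Icc 0 d.T := ⟨hτ.1.le, hτ.2.le.trans ht.2⟩
    obtain ⟨hint, hle⟩ := d.integral_abs_sum_fderiv_mul_inner_le hC hC0 hτI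
    have h1 := norm_integral_le_of_norm_le hint (Eventually.of_forall fun x => by
      rw [Real.norm_eq_abs]; exact Finset.abs_sum_le_sum_abs _ _)
    refine h1.trans (hle.trans ?_)
    have := d.sqrt_E2_le hM hM0 hτI
    have hF := Real.sqrt_nonneg (d.Fd τ)
    calc 3 * (Ccut / (R₂ - R₁)) * (Real.sqrt (d.Fd τ) * Real.sqrt (d.E2 τ)) ≤ 3 * (Ccut / (R₂ - R₁)) * (Real.sqrt (d.Fd τ) * M) := by
          gcongr
      _ = 3 * (Ccut / (R₂ - R₁)) * M * Real.sqrt (d.Fd τ) := by ring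
  have hgi : IntegrableOn (fun τ => 3 * (Ccut / (R₂ - R₁)) * M * Real.sqrt (d.Fd τ)) (Ioo 0 t) volume := by
    have := (d.integrableOn_Fd_rpow ht.2 (θ := 1 / 2) (by norm_num) (by norm_num)).const_mul (3 * (Ccut / (R₂ - R₁)) * M)
    refine this.congr (ae_of_all _ fun τ => ?_)
    simp only [Real.sqrt_eq_rpow]
  have h2 := norm_integral_le_of_norm_le hgi ((ae_restrict_iff' measurableSet_Ioo).2 (ae_of_all _ hslice))
  rw [Real.norm_eq_abs] at h2
  refine h2.trans ?_
  rw [integral_const_mul]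
  have h3 := d.integral_sqrt_Fd_le ht
  have : 0 ≤ 3 * (Ccut / (R₂ - R₁)) * M := by positivity
  exact mul_le_mul_of_nonneg_left h3 this

omit hM hM0 in
include hm in
/-- **The pressure error**: `|∫∫ p (Dη·u)| ≤ 9 (C₁/(R₂−R₁)) M (M K³)^{1/2} t^{1/4} D_all(t)^{3/4}`. [folklore] -/
theorem abs_pressure_error_le (hM : d.E2 0 ≤ M ^ 2) (hM0 : 0 ≤ M) {t : ℝ} (ht : t ∈ Icc 0 d.T) :
    |∫ τ in Ioo 0 t, ∫ x, d.p τ x * fderiv ℝ (taoCutoff R₂ (R₂ - R₁)) x (d.u τ x)| ≤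
      9 * (Ccut / (R₂ - R₁)) * M * Real.sqrt (M * KS ^ 3) * (t ^ (1 / 4 : ℝ) * d.Dall t ^ (3 / 4 : ℝ)) := by
  set η : E3 → ℝ := taoCutoff R₂ (R₂ - R₁) with hηdef
  have hr : 0 < R₂ - R₁ := sub_pos.2 h12
  have hR₂ : 0 < R₂ := hR₁.trans h12
  have hC : ∀ x, ‖fderiv ℝ η x‖ ≤ Ccut / (R₂ - R₁) := norm_fderiv_taoCutoff_le_Ccut hr hR₂
  have hC0 : 0 ≤ Ccut / (R₂ - R₁) := div_nonneg Ccut_pos.le hr.le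
  set A : ℝ := 9 * (Ccut / (R₂ - R₁)) * M * Real.sqrt (M * KS ^ 3) with hA
  have hA0 : 0 ≤ A := by have := KS_nonneg; positivity
  have hslice : ∀ τ ∈ Ioo 0 t, ‖∫ x, d.p τ x * fderiv ℝ η x (d.u τ x)‖ ≤ A * d.Fd τ ^ (3 / 4 : ℝ) := by
    intro τ hτ
    have hτI : τ ∈ Icc 0 d.T := ⟨hτ.1.le, hτ.2.le.trans ht.2⟩
    obtain ⟨hint, hle⟩ := d.integral_abs_p_mul_norm_le χ hm hτI
    have hpt : ∀ x, ‖d.p τ x * fderiv ℝ η x (d.u τ x)‖ ≤ (Ccut / (R₂ - R₁)) * (|d.p τ x| * ‖d.u τ x‖) := by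
      intro x
      rw [norm_mul, Real.norm_eq_abs, Real.norm_eq_abs]
      calc |d.p τ x| * |fderiv ℝ η x (d.u τ x)| ≤ |d.p τ x| * ((Ccut / (R₂ - R₁)) * ‖d.u τ x‖) := by
            refine mul_le_mul_of_nonneg_left ?_ (abs_nonneg _)
            calc |fderiv ℝ η x (d.u τ x)| = ‖fderiv ℝ η x (d.u τ x)‖ := (Real.norm_eq_abs _).symm
              _ ≤ ‖fderiv ℝ η x‖ * ‖d.u τ x‖ := ContinuousLinearMap.le_opNorm _ _
              _ ≤ (Ccut / (R₂ - R₁)) * ‖d.u τ x‖ := mul_le_mul_of_nonneg_right (hC x) (norm_nonneg _)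
        _ = (Ccut / (R₂ - R₁)) * (|d.p τ x| * ‖d.u τ x‖) := by ring
    have h1 := norm_integral_le_of_norm_le (hint.const_mul _) (Eventually.of_forall hpt)
    refine h1.trans ?_
    rw [integral_const_mul]
    have hE := d.sqrt_E2_le hM hM0 hτI
    have h4 := d.sqrt_integral_norm_pow_four_le hM hM0 hτI
    have hP0 : 0 ≤ Real.sqrt (M * KS ^ 3) * d.Fd τ ^ (3 / 4 : ℝ) :=
      mul_nonneg (Real.sqrt_nonneg _) (Real.rpow_nonneg (d.Fd_nonneg τ) _)
    calc (Ccut / (R₂ - R₁)) * ∫ x, |d.p τ x| * ‖d.u τ x‖ ≤ (Ccut / (R₂ - R₁)) * (9 * Real.sqrt (∫ x, ‖d.u τ x‖ ^ 4) * Real.sqrt (d.E2 τ)) :=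
          mul_le_mul_of_nonneg_left hle hC0
      _ ≤ (Ccut / (R₂ - R₁)) * (9 * (Real.sqrt (M * KS ^ 3) * d.Fd τ ^ (3 / 4 : ℝ)) * M) := by
          refine mul_le_mul_of_nonneg_left ?_ hC0
          exact mul_le_mul (mul_le_mul_of_nonneg_left h4 (by norm_num)) hE (Real.sqrt_nonneg _) (by positivity)
      _ = A * d.Fd τ ^ (3 / 4 : ℝ) := by rw [hA]; ring
  have hgi : IntegrableOn (fun τ => A * d.Fd τ ^ (3 / 4 : ℝ)) (Ioo 0 t) volume :=
    (d.integrableOn_Fd_rpow ht.2 (by norm_num) (by norm_num)).const_mul A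
  have h2 := norm_integral_le_of_norm_le hgi ((ae_restrict_iff' measurableSet_Ioo).2 (ae_of_all _ hslice))
  rw [Real.norm_eq_abs] at h2
  refine h2.trans ?_
  rw [integral_const_mul]
  exact mul_le_mul_of_nonneg_left (d.integral_Fd_rpow_three_quarters_le ht) hA0

omit hM hM0 in
include hm in
/-- **The transport error**: `|∫∫ (Dη·Ju) ‖u‖²| ≤ (C₁/(R₂−R₁)) M (M K³)^{1/2} t^{1/4} D_all(t)^{3/4}`. [folklore] -/
theorem abs_transport_error_le (hM : d.E2 0 ≤ M ^ 2) (hM0 : 0 ≤ M) {t : ℝ} (ht : t ∈ Icc 0 d.T) :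
    |∫ τ in Ioo 0 t, ∫ x, fderiv ℝ (taoCutoff R₂ (R₂ - R₁)) x (d.ju τ x) * ‖d.u τ x‖ ^ 2| ≤
      (Ccut / (R₂ - R₁)) * M * Real.sqrt (M * KS ^ 3) * (t ^ (1 / 4 : ℝ) * d.Dall t ^ (3 / 4 : ℝ)) := by
  set η : E3 → ℝ := taoCutoff R₂ (R₂ - R₁) with hηdef
  have hr : 0 < R₂ - R₁ := sub_pos.2 h12
  have hR₂ : 0 < R₂ := hR₁.trans h12
  have hC : ∀ x, ‖fderiv ℝ η x‖ ≤ Ccut / (R₂ - R₁) := norm_fderiv_taoCutoff_le_Ccut hr hR₂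
  have hC0 : 0 ≤ Ccut / (R₂ - R₁) := div_nonneg Ccut_pos.le hr.le
  set A : ℝ := (Ccut / (R₂ - R₁)) * M * Real.sqrt (M * KS ^ 3) with hA
  have hA0 : 0 ≤ A := by have := KS_nonneg; positivity
  have hslice : ∀ τ ∈ Ioo 0 t, ‖∫ x, fderiv ℝ η x (d.ju τ x) * ‖d.u τ x‖ ^ 2‖ ≤ A * d.Fd τ ^ (3 / 4 : ℝ) := by
    intro τ hτ
    have hτI : τ ∈ Icc 0 d.T := ⟨hτ.1.le, hτ.2.le.trans ht.2⟩
    have hle := d.integral_norm_ju_mul_norm_sq_le χ hm hτI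
    -- integrability of the majorant `(C/δ) ‖Ju‖ ‖u‖²`
    obtain ⟨hJ2, -⟩ := d.integral_norm_ju_sq_mul_norm_sq_le χ hm hτI
    have hjc : Continuous (d.ju τ) := (d.contDiff_ju hτI 1).continuous
    have huc := d.continuous_u hτI
    have hu2 : Integrable (fun x => ‖d.u τ x‖ ^ 2) volume := IsRegMild.integrable_normSq_of_memLp (d.memLp_u hτI)
    have hint : Integrable (fun x => ‖d.ju τ x‖ * ‖d.u τ x‖ ^ 2) volume := by
      refine ((hJ2.add hu2).div_const 2).mono' ((hjc.norm.mul (huc.norm.pow 2)).aestronglyMeasurable)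
        (Eventually.of_forall fun x => ?_)
      rw [Real.norm_of_nonneg (by positivity)]
      have := two_mul_le_add_sq (‖d.ju τ x‖ * ‖d.u τ x‖) ‖d.u τ x‖
      change ‖d.ju τ x‖ * ‖d.u τ x‖ ^ 2 ≤ (‖d.ju τ x‖ ^ 2 * ‖d.u τ x‖ ^ 2 + ‖d.u τ x‖ ^ 2) / 2
      nlinarith [norm_nonneg (d.ju τ x), norm_nonneg (d.u τ x)]
    have hpt : ∀ x, ‖fderiv ℝ η x (d.ju τ x) * ‖d.u τ x‖ ^ 2‖ ≤ (Ccut / (R₂ - R₁)) * (‖d.ju τ x‖ * ‖d.u τ x‖ ^ 2) := by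
      intro x
      rw [norm_mul, Real.norm_eq_abs, Real.norm_of_nonneg (by positivity)]
      calc |fderiv ℝ η x (d.ju τ x)| * ‖d.u τ x‖ ^ 2 ≤ ((Ccut / (R₂ - R₁)) * ‖d.ju τ x‖) * ‖d.u τ x‖ ^ 2 := by
            refine mul_le_mul_of_nonneg_right ?_ (by positivity)
            calc |fderiv ℝ η x (d.ju τ x)| = ‖fderiv ℝ η x (d.ju τ x)‖ := (Real.norm_eq_abs _).symm
              _ ≤ ‖fderiv ℝ η x‖ * ‖d.ju τ x‖ := ContinuousLinearMap.le_opNorm _ _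
              _ ≤ (Ccut / (R₂ - R₁)) * ‖d.ju τ x‖ := mul_le_mul_of_nonneg_right (hC x) (norm_nonneg _)
        _ = (Ccut / (R₂ - R₁)) * (‖d.ju τ x‖ * ‖d.u τ x‖ ^ 2) := by ring
    have h1 := norm_integral_le_of_norm_le (hint.const_mul _) (Eventually.of_forall hpt)
    refine h1.trans ?_
    rw [integral_const_mul]
    have hE := d.sqrt_E2_le hM hM0 hτI
    have h4 := d.sqrt_integral_norm_pow_four_le hM hM0 hτI
    calc (Ccut / (R₂ - R₁)) * ∫ x, ‖d.ju τ x‖ * ‖d.u τ x‖ ^ 2 ≤ (Ccut / (R₂ - R₁)) * (Real.sqrt (∫ x, ‖d.u τ x‖ ^ 4) * Real.sqrt (d.E2 τ)) :=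
          mul_le_mul_of_nonneg_left hle hC0
      _ ≤ (Ccut / (R₂ - R₁)) * ((Real.sqrt (M * KS ^ 3) * d.Fd τ ^ (3 / 4 : ℝ)) * M) := by
          refine mul_le_mul_of_nonneg_left ?_ hC0
          exact mul_le_mul h4 hE (Real.sqrt_nonneg _) (mul_nonneg (Real.sqrt_nonneg _) (Real.rpow_nonneg (d.Fd_nonneg τ) _))
      _ = A * d.Fd τ ^ (3 / 4 : ℝ) := by rw [hA]; ring
  have hgi : IntegrableOn (fun τ => A * d.Fd τ ^ (3 / 4 : ℝ)) (Ioo 0 t) volume :=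
    (d.integrableOn_Fd_rpow ht.2 (by norm_num) (by norm_num)).const_mul A
  have h2 := norm_integral_le_of_norm_le hgi ((ae_restrict_iff' measurableSet_Ioo).2 (ae_of_all _ hslice))
  rw [Real.norm_eq_abs] at h2
  refine h2.trans ?_
  rw [integral_const_mul]
  exact mul_le_mul_of_nonneg_left (d.integral_Fd_rpow_three_quarters_le ht) hA0

end Errors

/-! ### The far-field energy estimate -/

omit d in
/-- **The constant of the far-field estimate**, a function of `ν`, `M = ‖u₀‖_{L²}` and `t` only
(through the absolute cut-off constant `C₁` and the Sobolev constant `K`):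
`C̄(M, t) = C₁ (6ν M √t (M²/2ν)^{1/2} + 19 M (M K³)^{1/2} t^{1/4} (M²/2ν)^{3/4})`. [folklore] -/
def tailConst (ν M t : ℝ) : ℝ :=
  Ccut * (6 * ν * M * Real.sqrt t * Real.sqrt (M ^ 2 / (2 * ν)) +
    19 * M * Real.sqrt (M * KS ^ 3) * t ^ (1 / 4 : ℝ) * (M ^ 2 / (2 * ν)) ^ (3 / 4 : ℝ))

/-- **The far-field energy inequality** (Leray 1934, (5.7)–(5.8); Ożański–Pooley 2018, Lemma 6.34):
with `η = taoCutoff R₂ (R₂ − R₁)` and `E₂(0) ≤ M²`,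
`∫ (1 − η) ‖u(t)‖² ≤ ∫ (1 − η) ‖u(0)‖² + C̄(M, t)/(R₂ − R₁)`. [folklore] -/
theorem far_energy_le (hm : d.m = msymbol χ) {R₁ R₂ M : ℝ} (hR₁ : 0 < R₁) (h12 : R₁ < R₂) (hM : d.E2 0 ≤ M ^ 2)
    (hM0 : 0 ≤ M) {t : ℝ} (ht : t ∈ Icc 0 d.T) :
    ∫ x, (1 - taoCutoff R₂ (R₂ - R₁) x) * ‖d.u t x‖ ^ 2 ≤
      (∫ x, (1 - taoCutoff R₂ (R₂ - R₁) x) * ‖d.u 0 x‖ ^ 2) + tailConst d.ν M t / (R₂ - R₁) := by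
  have h0 := d.far_energy_le_errors hR₁ h12 ht
  have hV := d.abs_visc_error_le hR₁ h12 hM hM0 ht
  have hP := d.abs_pressure_error_le χ hm hR₁ h12 hM hM0 ht
  have hJ := d.abs_transport_error_le χ hm hR₁ h12 hM hM0 ht
  have hν := d.hν
  have hδ : 0 < R₂ - R₁ := sub_pos.2 h12
  have hC := Ccut_pos
  have hK := KS_nonneg
  obtain ⟨-, hDle⟩ := d.E2_le_and_Dall_le ht
  have hD0 := d.Dall_nonneg t
  have hB : d.Dall t ≤ M ^ 2 / (2 * d.ν) := hDle.trans (div_le_div_of_nonneg_right hM (by positivity))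
  have ht0 : 0 ≤ t := ht.1
  have hCδ : 0 ≤ Ccut / (R₂ - R₁) := div_nonneg hC.le hδ.le
  -- replace `D_all` by its bound `M²/(2ν)`
  have h1 : Real.sqrt (d.Dall t) ≤ Real.sqrt (M ^ 2 / (2 * d.ν)) := Real.sqrt_le_sqrt hB
  have h2 : d.Dall t ^ (3 / 4 : ℝ) ≤ (M ^ 2 / (2 * d.ν)) ^ (3 / 4 : ℝ) := Real.rpow_le_rpow hD0 hB (by norm_num)
  have hV' : |∫ τ in Ioo 0 t, ∫ x, ∑ i, fderiv ℝ (taoCutoff R₂ (R₂ - R₁)) x (stdOrthonormalBasis ℝ E3 i) *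
        ⟪fderiv ℝ (d.u τ) x (stdOrthonormalBasis ℝ E3 i), d.u τ x⟫| ≤
      3 * (Ccut / (R₂ - R₁)) * M * (Real.sqrt t * Real.sqrt (M ^ 2 / (2 * d.ν))) :=
    hV.trans (by gcongr)
  have hP' : |∫ τ in Ioo 0 t, ∫ x, d.p τ x * fderiv ℝ (taoCutoff R₂ (R₂ - R₁)) x (d.u τ x)| ≤
      9 * (Ccut / (R₂ - R₁)) * M * Real.sqrt (M * KS ^ 3) * (t ^ (1 / 4 : ℝ) * (M ^ 2 / (2 * d.ν)) ^ (3 / 4 : ℝ)) :=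
    hP.trans (by gcongr)
  have hJ' : |∫ τ in Ioo 0 t, ∫ x, fderiv ℝ (taoCutoff R₂ (R₂ - R₁)) x (d.ju τ x) * ‖d.u τ x‖ ^ 2| ≤
      (Ccut / (R₂ - R₁)) * M * Real.sqrt (M * KS ^ 3) * (t ^ (1 / 4 : ℝ) * (M ^ 2 / (2 * d.ν)) ^ (3 / 4 : ℝ)) :=
    hJ.trans (by gcongr)
  have hid : 2 * d.ν * (3 * (Ccut / (R₂ - R₁)) * M * (Real.sqrt t * Real.sqrt (M ^ 2 / (2 * d.ν)))) +
      2 * (9 * (Ccut / (R₂ - R₁)) * M * Real.sqrt (M * KS ^ 3) * (t ^ (1 / 4 : ℝ) * (M ^ 2 / (2 * d.ν)) ^ (3 / 4 : ℝ))) +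
      (Ccut / (R₂ - R₁)) * M * Real.sqrt (M * KS ^ 3) * (t ^ (1 / 4 : ℝ) * (M ^ 2 / (2 * d.ν)) ^ (3 / 4 : ℝ)) =
      tailConst d.ν M t / (R₂ - R₁) := by
    rw [tailConst]; field_simp; ring
  nlinarith [hV', hP', hJ', h0, hid, hν.le]

/-- **The far-field energy estimate in the form of `leray_regularised_wellposed`**: for
`0 < R₁ < R₂`, `t ∈ [0, T]` and `E₂(0) ≤ M²`,
`∫⁻_{‖x‖>R₂} ‖u(t)‖ₑ² ≤ ∫⁻_{‖x‖>R₁} ‖u(0)‖ₑ² + ofReal (C̄(M,t)/(R₂ − R₁))`. [folklore] -/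
theorem lintegral_far_le (hm : d.m = msymbol χ) {R₁ R₂ M : ℝ} (hR₁ : 0 < R₁) (h12 : R₁ < R₂) (hM : d.E2 0 ≤ M ^ 2)
    (hM0 : 0 ≤ M) {t : ℝ} (ht : t ∈ Icc 0 d.T) :
    ∫⁻ x in {x : E3 | R₂ < ‖x‖}, ‖d.u t x‖ₑ ^ 2 ≤
      (∫⁻ x in {x : E3 | R₁ < ‖x‖}, ‖d.u 0 x‖ₑ ^ 2) + ENNReal.ofReal (tailConst d.ν M t / (R₂ - R₁)) := by
  set η : E3 → ℝ := taoCutoff R₂ (R₂ - R₁) with hηdef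
  have hr : 0 < R₂ - R₁ := sub_pos.2 h12
  have hR₂ : 0 < R₂ := hR₁.trans h12
  have hη0 : ∀ x, 0 ≤ η x := fun x => taoCutoff_nonneg _ _ x
  have hηle : ∀ x, η x ≤ 1 := fun x => taoCutoff_le_one _ _ x
  have hηc : HasCompactSupport η := hasCompactSupport_taoCutoff hR₂.le hr.le
  have h0I : (0 : ℝ) ∈ Icc 0 d.T := ⟨le_rfl, d.hT.le⟩
  have hint : ∀ {s}, s ∈ Icc 0 d.T → Integrable (fun x => (1 - η x) * ‖d.u s x‖ ^ 2) volume := by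
    intro s hs
    have hu2 : Integrable (fun x => ‖d.u s x‖ ^ 2) volume := IsRegMild.integrable_normSq_of_memLp (d.memLp_u hs)
    have hη2 : Integrable (fun x => η x * ‖d.u s x‖ ^ 2) volume :=
      ((continuous_taoCutoff _ _).mul ((d.continuous_u hs).norm.pow 2)).integrable_of_hasCompactSupport hηc.mul_right
    exact (hu2.sub hη2).congr (Eventually.of_forall fun x => by simp only [Pi.sub_apply]; ring)
  have hS₁ : MeasurableSet {x : E3 | R₁ < ‖x‖} := measurableSet_lt measurable_const continuous_norm.measurable
  have hS₂ : MeasurableSet {x : E3 | R₂ < ‖x‖} := measurableSet_lt measurable_const continuous_norm.measurable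
  -- (a) the far field at time `t` against `∫ (1 - η) ‖u(t)‖²`
  have ha : ∫⁻ x in {x : E3 | R₂ < ‖x‖}, ‖d.u t x‖ₑ ^ 2 ≤ ENNReal.ofReal (∫ x, (1 - η x) * ‖d.u t x‖ ^ 2) := by
    rw [ofReal_integral_eq_lintegral_ofReal (hint ht) (Eventually.of_forall fun x => mul_nonneg (sub_nonneg.2 (hηle x))
      (sq_nonneg _)), ← lintegral_indicator hS₂]
    refine lintegral_mono fun x => ?_
    by_cases hx : x ∈ {x : E3 | R₂ < ‖x‖}
    · rw [indicator_of_mem hx, show η x = 0 from taoCutoff_eq_zero hR₂.le hr.le (le_of_lt hx), sub_zero, one_mul,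
        ← ofReal_norm, ENNReal.ofReal_pow (norm_nonneg _)]
    · rw [indicator_of_notMem hx]; exact zero_le
  -- (b) `∫ (1 - η) ‖u(0)‖²` against the far field at time `0`
  have hb : ENNReal.ofReal (∫ x, (1 - η x) * ‖d.u 0 x‖ ^ 2) ≤ ∫⁻ x in {x : E3 | R₁ < ‖x‖}, ‖d.u 0 x‖ₑ ^ 2 := by
    rw [ofReal_integral_eq_lintegral_ofReal (hint h0I) (Eventually.of_forall fun x => mul_nonneg (sub_nonneg.2 (hηle x))
      (sq_nonneg _)), ← lintegral_indicator hS₁]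
    refine lintegral_mono fun x => ?_
    by_cases hx : x ∈ {x : E3 | R₁ < ‖x‖}
    · rw [indicator_of_mem hx, ← ofReal_norm, ← ENNReal.ofReal_pow (norm_nonneg _)]
      refine ENNReal.ofReal_le_ofReal ?_
      calc (1 - η x) * ‖d.u 0 x‖ ^ 2 ≤ 1 * ‖d.u 0 x‖ ^ 2 := by gcongr; linarith [hη0 x]
        _ = ‖d.u 0 x‖ ^ 2 := one_mul _
    · rw [indicator_of_notMem hx]
      have hx' : ‖x‖ ≤ R₁ := not_lt.1 hx
      have hη1 : η x = 1 := taoCutoff_eq_one_of_norm_le hR₂ hr (by linarith) (by linarith)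
      simp [hη1]
  -- (c) combine with the real inequality
  have hc := d.far_energy_le χ hm hR₁ h12 hM hM0 ht
  calc ∫⁻ x in {x : E3 | R₂ < ‖x‖}, ‖d.u t x‖ₑ ^ 2 ≤ ENNReal.ofReal (∫ x, (1 - η x) * ‖d.u t x‖ ^ 2) := ha
    _ ≤ ENNReal.ofReal ((∫ x, (1 - η x) * ‖d.u 0 x‖ ^ 2) + tailConst d.ν M t / (R₂ - R₁)) := ENNReal.ofReal_le_ofReal hc
    _ ≤ ENNReal.ofReal (∫ x, (1 - η x) * ‖d.u 0 x‖ ^ 2) + ENNReal.ofReal (tailConst d.ν M t / (R₂ - R₁)) := ENNReal.ofReal_add_le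
    _ ≤ _ := add_le_add hb le_rfl

end RegSetup

end Literature.Analysis.FluidPDE.FourierNS

end
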